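import Mathlib
import Literature.NumberTheory.Sieve.Maynard2016DenseClustersRFoldSums
import Literature.NumberTheory.Sieve.Maynard2016DenseClustersMixedProfile
import Literature.NumberTheory.LFunctions.Zhang2022.Section8ArithmeticIdentity
import HarnessLib

/-!
# Maynard 2016 (*Dense clusters of primes in subsets*), proof of Lemma 9.3: the `e_m`-summation (display (9.29))

Topic `Literature/NumberTheory/Sieve`; namespace `Literature.NumberTheory.Sieve.MaynardDense`.
J. Maynard, *Dense clusters of primes in subsets*, Compositio Math. 152 (2016), 1517–1554 = arXiv:1405.2593
[Maynard2016DenseClusters], proof of Lemma 9.3, p. 24 of the arXiv version: after the local factors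
`S'^{(m)}_p` (9.24), the split `e_j = r_j s_j t_j` and the Euler product (9.28) («eq. stSum»), the remaining
one-variable sum over `e_m` is
`∑_{(e_m, rW_m) = 1} μ(e_m)² y_{r'} /(φ_ω(e_m) ∏_{p ∣ e_m}(p/(p−1) − 1/φ_ω(p)))`
(`r' = r` with `r_m ↦ e_m`, `y_{r'} ∝ F(t_1, …, log e_m/log R, …, t_k)`), and «using Lemma 8.3 we estimate the
summation over `e_m`» (display (9.29), «eq. emSummation»):
`= log R · ∏_{p ∣ rW_m}(1 − 1/p) ∏_{p ∤ rW_m}(p/(p−1) − 1/φ_ω(p))⁻¹ · (∫₀^∞ F dt_m + O(…))`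
(the factor `𝔖_{WB}(𝓛)W^kB^k/φ(WB)^k` printed there is the normalisation of `y`, display (7.7) p. 13).

This file is that step, DERIVED from the tree's PROVED Lemma 8.3 in the decoupled form
`MaynardDense.lemma83_gamma84_dec` (`Maynard2016DenseClustersSmoothedSums.lean` §4), for an abstract modulus
`M ≠ 0` (printed `M = rW_m`; in the error term (9.26) `M = a_m W B r`) divisible by every prime `p ≤ 2K₀²`, and an
abstract root-count `ω : ℕ → ℕ` (the consumer takes `ω = FGKMT2018.omegaL 𝓛`) with `ω(p) < p` at every prime
(admissibility) and `ω(p) ≤ K₀` at the primes `p ∤ M` (printed: `ω(p) ≤ k`, `K₀ = k`):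

* §1 the weight: in the `a_p`-parametrisation (8.13) of the tree (`γ(p) = p/a_p` off `M`), the `e_m`-weight is
  `g_γ` for `a_p = 1 + A_ω(p)`, `A_ω(p) = φ_ω(p)·p/(p−1) − 1 = p − ω(p) + (1 − ω(p))/(p−1)
  = φ_ω(p)(p/(p−1) − 1/φ_ω(p))` (`emA`), so `a_p = p(p − ω(p))/(p − 1)`, `|a_p − p| = p|ω(p) − 1|/(p−1) ≤ 2(K₀ − 1) ≤ K₀²`
  (`abs_one_add_emA_sub_le`) — the hypotheses of `lemma83_gamma84_dec` with `K₁ = 2(K₀ − 1)`;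
  `μ(e)² g_γ(e) = 1_{μ²(e)=1, (e,M)=1}/∏_{p∣e} A_ω(p) = 1_{…}/(φ_ω(e)∏_{p∣e}(p/(p−1) − 1/φ_ω(p)))` (`emWeight`,
  `moebius_sq_mul_g_emGamma`, `emWeight_eq_inv_phi_mul_prod`);
* §2 the constant: the Euler factors of `c_γ` are `1 − 1/p` (`p ∣ M`) and `(p/(p−1) − 1/φ_ω(p))⁻¹` (`p ∤ M`)
  (`cGammaPartial_emGamma`), the partial products converge (`tendsto_cGammaPartial_emGamma`, from the tree's proved
  GGPY Lemma 3), `c_γ > 0` (`cGamma_emGamma_pos`), and — the form in which (9.28) × (9.29) collapses to (9.30) —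
  `c_γ · ∏_{p<y, p∤M}(p/(p−1) − 1/φ_ω(p)) = ∏_{p<y, p∣M}(1 − 1/p) → φ(M)/M`, so that
  `∏_{p ∤ M}(p/(p−1) − 1/φ_ω(p))` converges (in this order) to `(φ(M)/M)/c_γ` (`cGammaPartial_mul_emEuler`,
  `tendsto_emEuler`, `cGamma_mul_lim_emEuler`);
* §3 the test function: the `t_m`-fibre `t ↦ F(u; u_m := t)` of the tree's `MaynardDense.F k`
  (= `ψ(t + ∑_{i≠m} uᵢ)·g_k(t)·∏_{i≠m} g_k(uᵢ)`, `F_update_eq`) has the global `C¹` representative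
  `fiberG k u m t = profExt k t · ψ(∑_{i≠m} uᵢ + t) · ∏_{i≠m} g_k(uᵢ)` with
  `sup_{[0,1]}(|G| + |G'|) ≤ 31(1 + 30/U_k + T_k)·|∏_{i≠m} g_k(uᵢ)|` (`fiberG_bounds`, from the tree's
  `testFn_bounds`, `abs_profExt_add_abs_deriv_le`, `abs_deriv_psi_le`) and `∫₀¹ G = ∫₀^∞ F(u; u_m := t) dt`
  (`intervalIntegral_fiberG`; printed `∫₀^∞ F dt_m`);
* §4 the statement: `emSum_estimate` (any `C¹` test function `G`) and **`emSummation`** (the `F`-fibre):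
  `|∑_{e<R} μ(e)² 1_{(e,M)=1} F(u; u_m := log e/log R)/∏_{p∣e}A_ω(p) − c_γ log R ∫₀^∞ F(u; u_m := t) dt|
   ≤ C c_γ (9 + ∑_{p∣M} log p/p) · 31(1 + 30/U_k + T_k) |∏_{i≠m} g_k(uᵢ)|`
  with an absolute `C` (printed: error `O(c_γ · log log R · T_k)` relative to `∏_{i≠m} g_k(uᵢ)`, absorbed on p. 24
  into `O(T_k (log log R)²/log R · F₂)` inside `H`; `31(1 + 30/U_k + T_k) ≤ 93 T_k` for `k ≥ 2^18`, `fiber_const_le`).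
* §5–§6 the same for the error term (9.26) («eq. YmError», `Y` in place of `y`, i.e. `F₂` in place of `F`):
  the profile `h_k(t) = ψ(t/2)/(1 + T_k t)` of `F₂` has `|h_k| + |h_k'| ≤ 16 + T_k` on `[0, ∞)` (its global `C¹`
  representative `prof₂Ext` is the tree's, `Maynard2016DenseClustersMixedProfile.lean` §1); the `t_m`-fibre of `F₂` is
  `F₂(u; u_m := t) = h_k(t)∏_{i≠m} g_k(uᵢ) + g_k(t)∑_{j≠m} h_k(u_j)∏_{i≠j,m} g_k(uᵢ)` (`F₂_update_eq`), with `C¹`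
  representative `fiberG₂`, `sup_{[0,1]}(|G| + |G'|) ≤ (16 + 30/U_k + T_k) F₂(u; u_m := 0)` (`fiberG₂_bounds`),
  `∫₀¹ G ≤ ∫₀^∞ F₂(u; u_m := t) dt = (∫h_k)∏_{i≠m}g_k(uᵢ) + L_k ∑_{j≠m}…` (`intervalIntegral_fiberG₂_le`,
  `setIntegral_Ici_F₂_update`, `F₂_update_zero_mul_ell_le`), whence the UPPER BOUND **`emSum_F₂_le`**:
  `∑_{e<R} μ(e)² 1_{(e,M)=1} F₂(u; u_m := log e/log R)/∏_{p∣e}A_ω(p)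
   ≤ c_γ log R ∫₀^∞ F₂(u; u_m := t) dt + C c_γ (9 + ∑_{p∣M} log p/p)(16 + 30/U_k + T_k) F₂(u; u_m := 0)`
  (printed: «using Lemma 8.4 to estimate the sum over e_m … ≪ … ∫₀^∞ F₂ dt_m»).
* §7 quantitative (9.30): `c_γ(y)·∏_{p<y,p∤M}(…) = ∏_{p<y, p∣M}(1 − 1/p)` for EVERY `y`
  (`cGammaPartial_mul_emEuler_eq`, no `y > M`), `|(p/(p−1) − 1/φ_ω(p))⁻¹ − 1| ≤ 2K₀/p²` for `p > 2K₀²`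
  (`abs_emFactor_inv_sub_one_le`), and for `y > 2K₀²`:
  `|c_γ · ∏_{p<y, p∤M}(p/(p−1) − 1/φ_ω(p)) − φ(M)/M| ≤ (e^{2K₀/(y−1)} − 1)·φ(M)/M ≤ (4K₀/y)·φ(M)/M`
  (`abs_cGamma_mul_emEuler_sub_le`, `abs_cGamma_mul_emEuler_sub_le'`).
* §8 the inner sums of the error term (9.26) (first display of p. 24), generic: the `t`-sum
  `∑_{t∣D, μ²(t)=1, (t,M)=1} (1 + ∑_{p∣t} log p)/φ_ω(t) ≤ ∏_{p∣D,p∤M}(1 + 2/p)·(1 + ∑_{p∣D,p∤M} 2 log p/p)`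
  (`sum_divisors_log_div_phiOmega_le`) and the `s`-sum `∑_{s∈S} K₀^{#primes(s)}(1 + log s)/(φ(s)φ_ω(s)) ≤ e⁶` for any
  finite set `S` of square-free numbers coprime to `M` (`sum_sqfree_coprime_pow_mul_log_div_le`).
* §9 the size of the `emSummation` error against `∫₀^∞ F₂ dt_m` (why (9.14)'s error is `O(T_k … ∫F₂ dt_m)` although
  `G_max ≍ T_k ∏_{i≠m} g_k(uᵢ)`): the `j ≠ m` terms of `F₂` give `(k−1)∏_{i≠m} g_k(uᵢ) ≤ ∑_{j≠m} h_k(u_j)∏_{i≠j,m} g_k(uᵢ)`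
  (`h_k ≥ g_k`), hence `k L_k ∏_{i≠m} g_k(uᵢ) ≤ ∫₀^∞ F₂(u; u_m := t) dt` (`mul_ell_mul_prod_le_setIntegral_F₂_update`) and, with
  `L_k T_k ≥ (log k)/2`, `T_k ∏_{i≠m} g_k(uᵢ) ≤ 2T_k ∫₀^∞ F₂(u; u_m := t) dt` (`T_mul_prod_le_two_mul_T_mul_setIntegral_F₂_update`,
  `k ≥ 2^18`).

Conventions: sums over `1 ≤ e < ⌈R⌉₊` as in `MaynardDense.smoothedSum`; terms with `∏ > R` or `∑ tᵢ ≥ 1` vanish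
through `ψ`/`g_k` (`psi_eq_zero`, `prof_eq_zero`), so the consumer's box conventions (`FGKMT2018.dkBoxP`) re-index
onto this range. No new named facts: everything is proved from the tree.

## References
* J. Maynard, *Dense clusters of primes in subsets*, Compositio Math. 152 (2016), 1517–1554; arXiv:1405.2593,
  Lemma 9.3 (p. 22, display (9.14)) and its proof pp. 23–24 (displays (9.23)–(9.30), in particular (9.29)),
  Lemma 8.3 p. 16, proof of Lemma 8.4 (8.13)–(8.14). [Maynard2016DenseClusters]
* D. A. Goldston, S. W. Graham, J. Pintz, C. Y. Yıldırım, *Small gaps between products of two primes*,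
  Proc. Lond. Math. Soc. (3) 98 (2009), 741–774, Lemmas 3–4. [GoldstonEtAl2008]
-/

noncomputable section

open Finset Filter Real
open scoped Topology ArithmeticFunction.Moebius

namespace Literature.NumberTheory.Sieve

namespace MaynardDense

/-! ## §1 The weight of the `e_m`-summation -/

/-- `A_ω(p) = φ_ω(p)·p/(p − 1) − 1` (`φ_ω(p) = p − ω(p)`): the reciprocal of the Euler factor of the
`e_m`-weight `1/(φ_ω(e_m) ∏_{p ∣ e_m}(p/(p−1) − 1/φ_ω(p)))` of (9.29), i.e. the `A(p)` of the tree's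
`a_p = 1 + A(p)` parametrisation (8.13) (`MaynardDense.moebius_sq_mul_g_gamma84`).
[cite: Maynard2016DenseClusters, proof of Lemma 9.3 p. 24, displays (9.28)–(9.29)] -/
def emA (ω : ℕ → ℕ) (p : ℕ) : ℝ := ((p : ℝ) - ω p) * p / ((p : ℝ) - 1) - 1

/-- The multiplicative function of Lemma 8.3 behind (9.29): `γ(p) = 0` for `p ∣ M`, `γ(p) = p/a_p`,
`a_p = 1 + A_ω(p) = p(p − ω(p))/(p − 1)` for `p ∤ M` (the tree's `gamma84 M a`).
[cite: Maynard2016DenseClusters, proof of Lemma 9.3 p. 24 (9.29) with proof of Lemma 8.4 (8.13)] -/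
def emGamma (M : ℕ) (ω : ℕ → ℕ) : ℕ → ℝ := gamma84 M fun p => 1 + emA ω p

/-- The `e_m`-weight of (9.29): `μ(e)² 1_{(e,M)=1}/∏_{p ∣ e} A_ω(p)`.
[cite: Maynard2016DenseClusters, proof of Lemma 9.3 p. 24, display (9.29) (left side)] -/
def emWeight (M : ℕ) (ω : ℕ → ℕ) (e : ℕ) : ℝ :=
  if Squarefree e ∧ Nat.Coprime e M then (∏ p ∈ e.primeFactors, emA ω p)⁻¹ else 0

/-- The `e_m`-sum of (9.29) against a one-variable test function `G` (`G(log e/log R)`), over `1 ≤ e < ⌈R⌉₊`.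
[cite: Maynard2016DenseClusters, proof of Lemma 9.3 p. 24, display (9.29) (left side)] -/
def emSum (M : ℕ) (ω : ℕ → ℕ) (G : ℝ → ℝ) (R : ℝ) : ℝ :=
  ∑ e ∈ Finset.Ico 1 ⌈R⌉₊, emWeight M ω e * G (Real.log e / Real.log R)

/-- The partial Euler products `∏_{p < y, p ∤ M} (p/(p−1) − 1/φ_ω(p))` of (9.28)/(9.29).
[cite: Maynard2016DenseClusters, proof of Lemma 9.3 p. 24, displays (9.28)–(9.29)] -/
def emEuler (M : ℕ) (ω : ℕ → ℕ) (y : ℕ) : ℝ :=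
  ∏ p ∈ (Nat.primesBelow y).filter (fun p => ¬p ∣ M), ((p : ℝ) / ((p : ℝ) - 1) - 1 / ((p : ℝ) - ω p))

/-- `emGamma M ω = gamma84 M (1 + A_ω)`. [cite: Maynard2016DenseClusters, proof of Lemma 9.3 p. 24 (9.29)] -/
theorem emGamma_eq (M : ℕ) (ω : ℕ → ℕ) : emGamma M ω = gamma84 M fun p => 1 + emA ω p := rfl

/-- `a_p = 1 + A_ω(p) = (p − ω(p))·p/(p − 1)`. [cite: Maynard2016DenseClusters, proof of Lemma 9.3 p. 24 (9.29)] -/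
theorem one_add_emA (ω : ℕ → ℕ) (p : ℕ) : 1 + emA ω p = ((p : ℝ) - ω p) * p / ((p : ℝ) - 1) := by
  unfold emA; ring

/-- `A_ω(p) = p − ω(p) + (1 − ω(p))/(p − 1)` at a prime.
[cite: Maynard2016DenseClusters, proof of Lemma 9.3 p. 24 (9.29)] -/
theorem emA_eq (ω : ℕ → ℕ) {p : ℕ} (hp : p.Prime) :
    emA ω p = (p : ℝ) - ω p + (1 - ω p) / ((p : ℝ) - 1) := by
  have h2 : (2 : ℝ) ≤ p := by exact_mod_cast hp.two_le
  have hp1 : (p : ℝ) - 1 ≠ 0 := by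
    have : 0 < (p : ℝ) - 1 := by linarith
    exact this.ne'
  unfold emA
  field_simp
  ring

/-- `A_ω(p) = φ_ω(p)·(p/(p−1) − 1/φ_ω(p))` at a prime with `ω(p) < p` — the printed Euler factor of the weight.
[cite: Maynard2016DenseClusters, proof of Lemma 9.3 p. 24, display (9.29) (the factor φ_ω(p)(p/(p−1) − 1/φ_ω(p)))] -/
theorem emA_eq_phi_mul (ω : ℕ → ℕ) {p : ℕ} (hp : p.Prime) (hω : ω p < p) :
    emA ω p = ((p : ℝ) - ω p) * ((p : ℝ) / ((p : ℝ) - 1) - 1 / ((p : ℝ) - ω p)) := by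
  have h2 : (2 : ℝ) ≤ p := by exact_mod_cast hp.two_le
  have hp1 : (p : ℝ) - 1 ≠ 0 := by
    have : 0 < (p : ℝ) - 1 := by linarith
    exact this.ne'
  have hφ : (p : ℝ) - ω p ≠ 0 := by
    have : (ω p : ℝ) < p := by exact_mod_cast hω
    have : 0 < (p : ℝ) - ω p := by linarith
    exact this.ne'
  unfold emA
  field_simp

/-- `A_ω(p) > 0` at a prime with `ω(p) < p` (`(p − ω)p ≥ p > p − 1`).
[cite: Maynard2016DenseClusters, proof of Lemma 9.3 p. 24 (9.29)] -/
theorem emA_pos (ω : ℕ → ℕ) {p : ℕ} (hp : p.Prime) (hω : ω p < p) : 0 < emA ω p := by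
  have h2 : (2 : ℝ) ≤ p := by exact_mod_cast hp.two_le
  have hp1 : 0 < (p : ℝ) - 1 := by linarith
  have hω1 : (ω p : ℝ) + 1 ≤ p := by exact_mod_cast Nat.succ_le_of_lt hω
  unfold emA
  rw [sub_pos, lt_div_iff₀ hp1]
  nlinarith

/-- The Euler factor `p/(p−1) − 1/φ_ω(p)` is positive at a prime with `ω(p) < p` (`p/(p−1) > 1 ≥ 1/φ_ω(p)`).
[cite: Maynard2016DenseClusters, proof of Lemma 9.3 p. 24, displays (9.28)–(9.29)] -/
theorem emFactor_pos (ω : ℕ → ℕ) {p : ℕ} (hp : p.Prime) (hω : ω p < p) :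
    0 < (p : ℝ) / ((p : ℝ) - 1) - 1 / ((p : ℝ) - ω p) := by
  have h2 : (2 : ℝ) ≤ p := by exact_mod_cast hp.two_le
  have hp1 : 0 < (p : ℝ) - 1 := by linarith
  have hω1 : (ω p : ℝ) + 1 ≤ p := by exact_mod_cast Nat.succ_le_of_lt hω
  have hφ : 0 < (p : ℝ) - ω p := by linarith
  have h1 : 1 < (p : ℝ) / ((p : ℝ) - 1) := by
    rw [one_lt_div hp1]; linarith
  have h3 : 1 / ((p : ℝ) - ω p) ≤ 1 := by
    rw [div_le_one hφ]; linarith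
  linarith

/-- **`|a_p − p| ≤ 2(K₀ − 1)`** for `a_p = p(p − ω(p))/(p − 1)` at a prime with `ω(p) ≤ K₀`, `K₀ ≥ 2`
(`a_p − p = −p(ω(p) − 1)/(p − 1)`, `p/(p−1) ≤ 2`, `|ω(p) − 1| ≤ K₀ − 1`): the deviation hypothesis of
`lemma83_gamma84_dec` with `K₁ = 2(K₀ − 1)` (printed: `g(p) = p − ω(p) + O(1)`, `ω(p) ≤ k`).
[cite: Maynard2016DenseClusters, proof of Lemma 9.3 p. 24 («using Lemma 8.3») with proof of Lemma 8.4 (8.13)–(8.14)] -/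
theorem abs_one_add_emA_sub_le (ω : ℕ → ℕ) {p : ℕ} (hp : p.Prime) {K₀ : ℝ} (hK₀ : 2 ≤ K₀)
    (hωK : (ω p : ℝ) ≤ K₀) : |1 + emA ω p - p| ≤ 2 * (K₀ - 1) := by
  rw [one_add_emA]
  have h2 : (2 : ℝ) ≤ p := by exact_mod_cast hp.two_le
  have hp1 : 0 < (p : ℝ) - 1 := by linarith
  have hω0 : (0 : ℝ) ≤ ω p := Nat.cast_nonneg _
  have heq : ((p : ℝ) - ω p) * p / ((p : ℝ) - 1) - p = -(((ω p : ℝ) - 1) * ((p : ℝ) / ((p : ℝ) - 1))) := by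
    field_simp
    ring
  rw [heq, abs_neg, abs_mul, abs_of_pos (div_pos (by linarith) hp1)]
  have hfrac : (p : ℝ) / ((p : ℝ) - 1) ≤ 2 := by
    rw [div_le_iff₀ hp1]; linarith
  have habs : |(ω p : ℝ) - 1| ≤ K₀ - 1 := by
    rw [abs_le]; constructor <;> linarith
  calc |(ω p : ℝ) - 1| * ((p : ℝ) / ((p : ℝ) - 1))
      ≤ (K₀ - 1) * 2 := mul_le_mul habs hfrac (div_pos (by linarith) hp1).le (by linarith)
    _ = 2 * (K₀ - 1) := by ring

/-- `2(K₀ − 1) ≤ K₀²` (so `K₁ = 2(K₀ − 1)` is admissible in `lemma83_gamma84_dec`). [folklore] -/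
private theorem two_mul_sub_one_le_sq (K₀ : ℝ) : 2 * (K₀ - 1) ≤ K₀ ^ 2 := by
  nlinarith [sq_nonneg (K₀ - 1)]

/-- The deviation hypothesis of `lemma83_gamma84_dec` for `a = 1 + A_ω`, `K₁ = 2(K₀ − 1)`.
[cite: Maynard2016DenseClusters, proof of Lemma 9.3 p. 24 («using Lemma 8.3») with proof of Lemma 8.4 (8.13)–(8.14)] -/
theorem emA_hyp {M : ℕ} {K₀ : ℝ} (hK₀ : 2 ≤ K₀) {ω : ℕ → ℕ}
    (hωK : ∀ p : ℕ, p.Prime → ¬p ∣ M → (ω p : ℝ) ≤ K₀) :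
    ∀ p : ℕ, p.Prime → ¬p ∣ M → |(fun p => 1 + emA ω p) p - p| ≤ 2 * (K₀ - 1) :=
  fun p hp hpM => abs_one_add_emA_sub_le ω hp hK₀ (hωK p hp hpM)

/-- **The weight is `μ² g_γ`**: `μ(e)² g_{γ}(e) = emWeight M ω e` for `e ≠ 0` (`γ = emGamma M ω`, `ω(p) < p` at
all primes): the left side of (9.29) is a `MaynardDense.smoothedSum`.
[cite: Maynard2016DenseClusters, proof of Lemma 9.3 p. 24, display (9.29) with proof of Lemma 8.4 (8.13)] -/
theorem moebius_sq_mul_g_emGamma {M : ℕ} {ω : ℕ → ℕ} (hω : ∀ p : ℕ, p.Prime → ω p < p) {e : ℕ}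
    (he : e ≠ 0) : ((μ e : ℤ) : ℝ) ^ 2 * GGPY.g (emGamma M ω) e = emWeight M ω e := by
  unfold emGamma emWeight
  exact moebius_sq_mul_g_gamma84 he fun p hp => by
    have := emA_pos ω (Nat.prime_of_mem_primeFactors hp) (hω _ (Nat.prime_of_mem_primeFactors hp))
    linarith

/-- `emWeight M ω e = 0` off the square-free `e` coprime to `M`.
[cite: Maynard2016DenseClusters, proof of Lemma 9.3 p. 24, display (9.29) (summation conditions)] -/
theorem emWeight_of_not {M : ℕ} (ω : ℕ → ℕ) {e : ℕ} (h : ¬(Squarefree e ∧ Nat.Coprime e M)) :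
    emWeight M ω e = 0 := by
  unfold emWeight; rw [if_neg h]

/-- `emWeight M ω e = 1/∏_{p ∣ e} A_ω(p)` on the square-free `e` coprime to `M`.
[cite: Maynard2016DenseClusters, proof of Lemma 9.3 p. 24, display (9.29)] -/
theorem emWeight_of {M : ℕ} (ω : ℕ → ℕ) {e : ℕ} (h : Squarefree e ∧ Nat.Coprime e M) :
    emWeight M ω e = (∏ p ∈ e.primeFactors, emA ω p)⁻¹ := by
  unfold emWeight; rw [if_pos h]

/-- `emWeight M ω e ≥ 0` (`ω(p) < p` at the primes of `e`).
[cite: Maynard2016DenseClusters, proof of Lemma 9.3 p. 24, display (9.29)] -/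
theorem emWeight_nonneg {M : ℕ} {ω : ℕ → ℕ} {e : ℕ} (hω : ∀ p ∈ e.primeFactors, ω p < p) :
    0 ≤ emWeight M ω e := by
  unfold emWeight
  split_ifs
  · exact inv_nonneg.2 (Finset.prod_nonneg fun p hp =>
      (emA_pos ω (Nat.prime_of_mem_primeFactors hp) (hω p hp)).le)
  · exact le_rfl

/-- **The printed form of the weight**: on the square-free `e` coprime to `M` (with `ω(p) < p` at its primes),
`emWeight M ω e = 1/(φ_ω(e) · ∏_{p ∣ e}(p/(p−1) − 1/φ_ω(p)))`, `φ_ω(e) = ∏_{p ∣ e}(p − ω(p))`.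
[cite: Maynard2016DenseClusters, proof of Lemma 9.3 p. 24, display (9.29) (left side)] -/
theorem emWeight_eq_inv_phi_mul_prod {M : ℕ} {ω : ℕ → ℕ} {e : ℕ} (hω : ∀ p ∈ e.primeFactors, ω p < p)
    (h : Squarefree e ∧ Nat.Coprime e M) :
    emWeight M ω e =
      ((∏ p ∈ e.primeFactors, ((p : ℝ) - ω p)) *
        ∏ p ∈ e.primeFactors, ((p : ℝ) / ((p : ℝ) - 1) - 1 / ((p : ℝ) - ω p)))⁻¹ := by
  rw [emWeight_of ω h, ← Finset.prod_mul_distrib]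
  congr 1
  exact Finset.prod_congr rfl fun p hp => emA_eq_phi_mul ω (Nat.prime_of_mem_primeFactors hp) (hω p hp)

/-- **The `e_m`-sum is the smoothed sum of Lemma 8.3** for `γ = emGamma M ω`.
[cite: Maynard2016DenseClusters, proof of Lemma 9.3 p. 24 («using Lemma 8.3 we estimate the summation over e_m»)] -/
theorem emSum_eq_smoothedSum {M : ℕ} {ω : ℕ → ℕ} (hω : ∀ p : ℕ, p.Prime → ω p < p) (G : ℝ → ℝ) (R : ℝ) :
    emSum M ω G R = smoothedSum (emGamma M ω) G R := by
  unfold emSum smoothedSum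
  refine Finset.sum_congr rfl fun e he => ?_
  have he0 : e ≠ 0 := by have := (Finset.mem_Ico.1 he).1; omega
  rw [moebius_sq_mul_g_emGamma hω he0]

/-! ## §2 The hypotheses of Lemma 8.3 and the constant `c_γ` -/

/-- `(Ω₁)` with `A₁' = 2` and `(Ω₂)` with `A₂ = 15`, `L = 11 + ∑_{p∣M} log p/p` for `γ = emGamma M ω`, when `M ≠ 0`
is divisible by every prime `p ≤ 2K₀²` (`K₀ ≥ 2`) and `ω(p) ≤ K₀` at the primes `p ∤ M`
(`hyp_gamma84_dec` with `K₁ = 2(K₀ − 1) ≤ K₀²`).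
[cite: Maynard2016DenseClusters, proof of Lemma 9.3 p. 24 («using Lemma 8.3») with proof of Lemma 8.4 (8.13)–(8.14)] -/
theorem hyp_emGamma {M : ℕ} (hM : M ≠ 0) {K₀ : ℝ} (hK₀ : 2 ≤ K₀)
    (hsmall : ∀ p : ℕ, p.Prime → (p : ℝ) ≤ 2 * K₀ ^ 2 → p ∣ M) {ω : ℕ → ℕ}
    (hωK : ∀ p : ℕ, p.Prime → ¬p ∣ M → (ω p : ℝ) ≤ K₀) :
    GGPY.HypOmega1 (emGamma M ω) 2 ∧
      GGPY.HypOmega2 (emGamma M ω) 1 15 (11 + ∑ p ∈ M.primeFactors, Real.log p / p) :=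
  hyp_gamma84_dec hM hK₀ (two_mul_sub_one_le_sq K₀) (emA_hyp hK₀ hωK) hsmall

/-- The partial products of `c_γ` converge, `γ = emGamma M ω` (the tree's proved GGPY Lemma 3).
[cite: Maynard2016DenseClusters, proof of Lemma 9.3 p. 24 (9.29) with Lemma 8.3 p. 16 (c_γ)] -/
theorem tendsto_cGammaPartial_emGamma {M : ℕ} (hM : M ≠ 0) {K₀ : ℝ} (hK₀ : 2 ≤ K₀)
    (hsmall : ∀ p : ℕ, p.Prime → (p : ℝ) ≤ 2 * K₀ ^ 2 → p ∣ M) {ω : ℕ → ℕ}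
    (hωK : ∀ p : ℕ, p.Prime → ¬p ∣ M → (ω p : ℝ) ≤ K₀) :
    Tendsto (GGPY.cGammaPartial (emGamma M ω)) atTop (𝓝 (GGPY.cGamma (emGamma M ω))) :=
  tendsto_cGammaPartial_gamma84_dec hM hK₀ (two_mul_sub_one_le_sq K₀) (emA_hyp hK₀ hωK) hsmall

/-- **`c_γ > 0`** for `γ = emGamma M ω` (`c_γ ≥ 0` as a limit of positive partial products, and `c_γ ≠ 0` since
Lemma 3 at `z = 2` reads `|1 − c_γ log 2| ≤ C c_γ L`).
[cite: Maynard2016DenseClusters, proof of Lemma 9.3 p. 24 (9.29) with Lemma 8.3 p. 16 (c_γ)] -/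
theorem cGamma_emGamma_pos {M : ℕ} (hM : M ≠ 0) {K₀ : ℝ} (hK₀ : 2 ≤ K₀)
    (hsmall : ∀ p : ℕ, p.Prime → (p : ℝ) ≤ 2 * K₀ ^ 2 → p ∣ M) {ω : ℕ → ℕ}
    (hωK : ∀ p : ℕ, p.Prime → ¬p ∣ M → (ω p : ℝ) ≤ K₀) :
    0 < GGPY.cGamma (emGamma M ω) := by
  obtain ⟨C, hC⟩ := GGPY.moebiusSqGSum_asymptotic_holds 2 15 (by norm_num) (by norm_num)
  obtain ⟨h1, h2⟩ := hyp_emGamma hM hK₀ hsmall hωK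
  have hL : (1 : ℝ) ≤ 11 + ∑ p ∈ M.primeFactors, Real.log p / p := by
    have : 0 ≤ ∑ p ∈ M.primeFactors, Real.log p / p := Finset.sum_nonneg fun p hp => by
      have := (Nat.prime_of_mem_primeFactors hp).pos; positivity
    linarith
  obtain ⟨ht, hz⟩ := hC _ hL _ h1 h2
  have h0 : 0 ≤ GGPY.cGamma (emGamma M ω) := GGPY.cGamma_nonneg (by norm_num) h1 ht
  rcases h0.lt_or_eq with h | h
  · exact h
  · exfalso
    have h22 := hz 2 le_rfl
    rw [GGPY.moebiusSqGSum_two, ← h] at h22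
    norm_num at h22

/-- The Euler factor of `c_γ` at a prime `p ∣ M` is `1 − 1/p` (`γ(p) = 0`).
[cite: Maynard2016DenseClusters, proof of Lemma 9.3 p. 24, display (9.29) (the factor ∏_{p∣rW_m}(1 − 1/p))] -/
theorem cGammaFactor_emGamma_of_dvd {M : ℕ} (ω : ℕ → ℕ) {p : ℕ} (h : p ∣ M) :
    (1 - emGamma M ω p / p)⁻¹ * (1 - 1 / (p : ℝ)) = 1 - 1 / (p : ℝ) := by
  unfold emGamma
  rw [gamma84_of_dvd _ h]
  simp

/-- The Euler factor of `c_γ` at a prime `p ∤ M` with `ω(p) < p` is `(p/(p−1) − 1/φ_ω(p))⁻¹`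
(`γ(p)/p = (p−1)/(p φ_ω(p))`).
[cite: Maynard2016DenseClusters, proof of Lemma 9.3 p. 24, display (9.29) (the factor ∏_{p∤rW_m}(p/(p−1) − 1/φ_ω(p))⁻¹)] -/
theorem cGammaFactor_emGamma_of_not_dvd {M : ℕ} {ω : ℕ → ℕ} {p : ℕ} (hp : p.Prime) (h : ¬p ∣ M)
    (hω : ω p < p) :
    (1 - emGamma M ω p / p)⁻¹ * (1 - 1 / (p : ℝ)) =
      ((p : ℝ) / ((p : ℝ) - 1) - 1 / ((p : ℝ) - ω p))⁻¹ := by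
  unfold emGamma
  rw [gamma84_of_not_dvd _ h, one_add_emA]
  have h2 : (2 : ℝ) ≤ p := by exact_mod_cast hp.two_le
  have hp0 : (p : ℝ) ≠ 0 := by positivity
  have hp1 : (p : ℝ) - 1 ≠ 0 := by
    have : 0 < (p : ℝ) - 1 := by linarith
    exact this.ne'
  have hω1 : (ω p : ℝ) + 1 ≤ p := by exact_mod_cast Nat.succ_le_of_lt hω
  have hφ : (p : ℝ) - ω p ≠ 0 := by
    have : 0 < (p : ℝ) - ω p := by linarith
    exact this.ne'
  -- the common numerator `D = p φ_ω(p) − (p − 1) > 0`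
  have hD : (p : ℝ) * ((p : ℝ) - ω p) - ((p : ℝ) - 1) ≠ 0 := by
    have : 0 < (p : ℝ) * ((p : ℝ) - ω p) - ((p : ℝ) - 1) := by nlinarith
    exact this.ne'
  have e1 : 1 - (p : ℝ) / (((p : ℝ) - ω p) * p / ((p : ℝ) - 1)) / p =
      ((p : ℝ) * ((p : ℝ) - ω p) - ((p : ℝ) - 1)) / ((p : ℝ) * ((p : ℝ) - ω p)) := by
    field_simp
  have e2 : (p : ℝ) / ((p : ℝ) - 1) - 1 / ((p : ℝ) - ω p) =
      ((p : ℝ) * ((p : ℝ) - ω p) - ((p : ℝ) - 1)) / (((p : ℝ) - 1) * ((p : ℝ) - ω p)) := by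
    field_simp
  rw [e1, e2, inv_div, inv_div]
  field_simp

/-- `{p < y prime : p ∣ M} = primeFactors M` once `y > M ≠ 0`. [folklore] -/
private theorem filter_primesBelow_dvd_eq {M : ℕ} (hM : M ≠ 0) {y : ℕ} (hy : M < y) :
    (Nat.primesBelow y).filter (· ∣ M) = M.primeFactors := by
  ext p
  simp only [Finset.mem_filter, Nat.mem_primesBelow, Nat.mem_primeFactors]
  constructor
  · rintro ⟨⟨-, hp⟩, hd⟩
    exact ⟨hp, hd, hM⟩
  · rintro ⟨hp, hd, -⟩
    exact ⟨⟨lt_of_le_of_lt (Nat.le_of_dvd (Nat.pos_of_ne_zero hM) hd) hy, hp⟩, hd⟩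

/-- **The Euler product of `c_γ`** (`γ = emGamma M ω`, `ω(p) < p` at the primes `p ∤ M`): for every `y`,
`∏_{p<y}(1 − γ(p)/p)⁻¹(1 − 1/p) = ∏_{p<y, p∣M}(1 − 1/p) · ∏_{p<y, p∤M}(p/(p−1) − 1/φ_ω(p))⁻¹`.
[cite: Maynard2016DenseClusters, proof of Lemma 9.3 p. 24, display (9.29) (right side: the two products)] -/
theorem cGammaPartial_emGamma {M : ℕ} {ω : ℕ → ℕ} (hω : ∀ p : ℕ, p.Prime → ¬p ∣ M → ω p < p) (y : ℕ) :
    GGPY.cGammaPartial (emGamma M ω) y =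
      (∏ p ∈ (Nat.primesBelow y).filter (· ∣ M), (1 - 1 / (p : ℝ))) *
        ∏ p ∈ (Nat.primesBelow y).filter (fun p => ¬p ∣ M),
          ((p : ℝ) / ((p : ℝ) - 1) - 1 / ((p : ℝ) - ω p))⁻¹ := by
  unfold GGPY.cGammaPartial
  rw [← Finset.prod_filter_mul_prod_filter_not (Nat.primesBelow y) (fun p => p ∣ M)]
  congr 1
  · exact Finset.prod_congr rfl fun p hp => cGammaFactor_emGamma_of_dvd ω (Finset.mem_filter.1 hp).2
  · exact Finset.prod_congr rfl fun p hp => by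
      have h := Finset.mem_filter.1 hp
      have hpr := (Nat.mem_primesBelow.1 h.1).2
      exact cGammaFactor_emGamma_of_not_dvd hpr h.2 (hω p hpr h.2)

/-- **(9.28) × (9.29) → (9.30)**: the partial products of `c_γ` times the Euler factors `∏_{p<y, p∤M}(p/(p−1) − 1/φ_ω(p))`
equal `∏_{p ∣ M}(1 − 1/p) = φ(M)/M` as soon as `y > M` (`ω(p) < p` at the primes `p ∤ M`).
[cite: Maynard2016DenseClusters, proof of Lemma 9.3 p. 24, displays (9.28)–(9.30) («combining (9.28) and (9.29) gives»)] -/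
theorem cGammaPartial_mul_emEuler {M : ℕ} (hM : M ≠ 0) {ω : ℕ → ℕ}
    (hω : ∀ p : ℕ, p.Prime → ¬p ∣ M → ω p < p) {y : ℕ} (hy : M < y) :
    GGPY.cGammaPartial (emGamma M ω) y * emEuler M ω y = ∏ p ∈ M.primeFactors, (1 - 1 / (p : ℝ)) := by
  rw [cGammaPartial_emGamma hω y, filter_primesBelow_dvd_eq hM hy, mul_assoc]
  conv_rhs => rw [← mul_one (∏ p ∈ M.primeFactors, (1 - 1 / (p : ℝ)))]
  congr 1
  unfold emEuler
  rw [← Finset.prod_mul_distrib]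
  refine Finset.prod_eq_one fun p hp => ?_
  have h := Finset.mem_filter.1 hp
  have hpr := (Nat.mem_primesBelow.1 h.1).2
  exact inv_mul_cancel₀ (emFactor_pos ω hpr (hω p hpr h.2)).ne'

/-- **(9.28) × (9.29), every `y`** (no `y > M` needed — in the application `M = a_m W B ∏ rᵢ` may have prime
factors beyond `y = ⌊R⌋ + 1`): `c_γ(y) · ∏_{p<y, p∤M}(p/(p−1) − 1/φ_ω(p)) = ∏_{p<y, p∣M}(1 − 1/p)`
(`ω(p) < p` at the primes `p ∤ M`).
[cite: Maynard2016DenseClusters, proof of Lemma 9.3 p. 24, displays (9.28)–(9.30)] -/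
theorem cGammaPartial_mul_emEuler_eq {M : ℕ} {ω : ℕ → ℕ}
    (hω : ∀ p : ℕ, p.Prime → ¬p ∣ M → ω p < p) (y : ℕ) :
    GGPY.cGammaPartial (emGamma M ω) y * emEuler M ω y =
      ∏ p ∈ (Nat.primesBelow y).filter (· ∣ M), (1 - 1 / (p : ℝ)) := by
  rw [cGammaPartial_emGamma hω y, mul_assoc]
  conv_rhs => rw [← mul_one (∏ p ∈ (Nat.primesBelow y).filter (· ∣ M), (1 - 1 / (p : ℝ)))]
  congr 1
  unfold emEuler
  rw [← Finset.prod_mul_distrib]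
  refine Finset.prod_eq_one fun p hp => ?_
  have h := Finset.mem_filter.1 hp
  have hpr := (Nat.mem_primesBelow.1 h.1).2
  exact inv_mul_cancel₀ (emFactor_pos ω hpr (hω p hpr h.2)).ne'

/-- `{p < y prime : p ∣ M} = {p ∈ primeFactors M : p < y}` (`M ≠ 0`). [folklore] -/
private theorem filter_primesBelow_dvd_eq_filter {M : ℕ} (hM : M ≠ 0) (y : ℕ) :
    (Nat.primesBelow y).filter (· ∣ M) = M.primeFactors.filter (· < y) := by
  ext p
  simp only [Finset.mem_filter, Nat.mem_primesBelow, Nat.mem_primeFactors]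
  constructor
  · rintro ⟨⟨hy, hp⟩, hd⟩
    exact ⟨⟨hp, hd, hM⟩, hy⟩
  · rintro ⟨⟨hp, hd, -⟩, hy⟩
    exact ⟨⟨hy, hp⟩, hd⟩

/-- The same with the right side indexed by the prime factors of `M` below `y` (`M ≠ 0`):
`c_γ(y) · ∏_{p<y, p∤M}(p/(p−1) − 1/φ_ω(p)) = ∏_{p ∣ M, p < y}(1 − 1/p)`.
[cite: Maynard2016DenseClusters, proof of Lemma 9.3 p. 24, displays (9.28)–(9.30)] -/
theorem cGammaPartial_mul_emEuler_eq' {M : ℕ} (hM : M ≠ 0) {ω : ℕ → ℕ}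
    (hω : ∀ p : ℕ, p.Prime → ¬p ∣ M → ω p < p) (y : ℕ) :
    GGPY.cGammaPartial (emGamma M ω) y * emEuler M ω y =
      ∏ p ∈ M.primeFactors.filter (· < y), (1 - 1 / (p : ℝ)) := by
  rw [cGammaPartial_mul_emEuler_eq hω y, filter_primesBelow_dvd_eq_filter hM y]

/-- `∏_{p ∣ M}(1 − 1/p) = φ(M)/M` (`M ≠ 0`). [folklore] -/
private theorem prod_primeFactors_one_sub_inv {M : ℕ} (hM : M ≠ 0) :
    ∏ p ∈ M.primeFactors, (1 - 1 / (p : ℝ)) = (Nat.totient M : ℝ) / M := by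
  have hM0 : (M : ℝ) ≠ 0 := by exact_mod_cast hM
  rw [LFunctions.Zhang2022.totient_eq_mul_prod_real M, mul_div_cancel_left₀ _ hM0]

/-- Hence `c_γ(y) · ∏_{p<y, p∤M}(p/(p−1) − 1/φ_ω(p)) → φ(M)/M` (eventually constant).
[cite: Maynard2016DenseClusters, proof of Lemma 9.3 p. 24, displays (9.28)–(9.30)] -/
theorem tendsto_cGammaPartial_mul_emEuler {M : ℕ} (hM : M ≠ 0) {ω : ℕ → ℕ}
    (hω : ∀ p : ℕ, p.Prime → ¬p ∣ M → ω p < p) :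
    Tendsto (fun y => GGPY.cGammaPartial (emGamma M ω) y * emEuler M ω y) atTop
      (𝓝 ((Nat.totient M : ℝ) / M)) := by
  rw [← prod_primeFactors_one_sub_inv hM]
  refine tendsto_const_nhds.congr' (Filter.eventually_atTop.2 ⟨M + 1, fun y hy => ?_⟩)
  exact (cGammaPartial_mul_emEuler hM hω (by omega)).symm

/-- **The Euler product of (9.28) converges**: `∏_{p<y, p∤M}(p/(p−1) − 1/φ_ω(p)) → (φ(M)/M)/c_γ` as `y → ∞`
(in this order; `c_γ > 0`), under the hypotheses of `cGamma_emGamma_pos` and `ω(p) < p` at the primes `p ∤ M`.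
[cite: Maynard2016DenseClusters, proof of Lemma 9.3 p. 24, displays (9.28)–(9.30)] -/
theorem tendsto_emEuler {M : ℕ} (hM : M ≠ 0) {K₀ : ℝ} (hK₀ : 2 ≤ K₀)
    (hsmall : ∀ p : ℕ, p.Prime → (p : ℝ) ≤ 2 * K₀ ^ 2 → p ∣ M) {ω : ℕ → ℕ}
    (hωK : ∀ p : ℕ, p.Prime → ¬p ∣ M → (ω p : ℝ) ≤ K₀) (hω : ∀ p : ℕ, p.Prime → ¬p ∣ M → ω p < p) :
    Tendsto (emEuler M ω) atTop
      (𝓝 (((Nat.totient M : ℝ) / M) / GGPY.cGamma (emGamma M ω))) := by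
  have hc := tendsto_cGammaPartial_emGamma hM hK₀ hsmall hωK
  have hpos := cGamma_emGamma_pos hM hK₀ hsmall hωK
  have h1 := (hyp_emGamma hM hK₀ hsmall hωK).1
  have hne : ∀ y, GGPY.cGammaPartial (emGamma M ω) y ≠ 0 := fun y =>
    (GGPY.cGammaPartial_pos (by norm_num) h1 y).ne'
  have h := (tendsto_cGammaPartial_mul_emEuler hM hω).div hc hpos.ne'
  refine h.congr fun y => ?_
  simp only [Pi.div_apply]
  exact mul_div_cancel_left₀ _ (hne y)

/-- Equivalently `c_γ · lim_y ∏_{p<y, p∤M}(p/(p−1) − 1/φ_ω(p)) = φ(M)/M` — the cancellation that turns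
(9.28) × (9.29) into the finite prefactor `∏_{p ∣ r}(1 − 1/p) ∏_{p ∣ WBa_m, p ∤ r}(1 − 1/p)` of (9.30).
[cite: Maynard2016DenseClusters, proof of Lemma 9.3 p. 24, displays (9.28)–(9.30)] -/
theorem cGamma_mul_lim_emEuler {M : ℕ} (hM : M ≠ 0) {K₀ : ℝ} (hK₀ : 2 ≤ K₀)
    (hsmall : ∀ p : ℕ, p.Prime → (p : ℝ) ≤ 2 * K₀ ^ 2 → p ∣ M) {ω : ℕ → ℕ}
    (hωK : ∀ p : ℕ, p.Prime → ¬p ∣ M → (ω p : ℝ) ≤ K₀) (hω : ∀ p : ℕ, p.Prime → ¬p ∣ M → ω p < p) :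
    GGPY.cGamma (emGamma M ω) * limUnder atTop (emEuler M ω) = (Nat.totient M : ℝ) / M := by
  rw [(tendsto_emEuler hM hK₀ hsmall hωK hω).limUnder_eq]
  have hpos := cGamma_emGamma_pos hM hK₀ hsmall hωK
  field_simp

/-! ## §3 The test function: the `t_m`-fibre of `F` -/

section Fiber

variable {k : ℕ}

/-- The `t_m`-fibre of `F = F_k` through `u`, as a globally `C¹` function of `t`:
`profExt k t · ψ(∑_{i≠m} uᵢ + t) · ∏_{i≠m} g_k(uᵢ)` (`= F(u; u_m := t)` for `t ≥ 0`).
[cite: Maynard2016DenseClusters, proof of Lemma 9.3 p. 24, display (9.29) («∫₀^∞ H(t_1,…,t_k) dt_m», «we have written r_i = R^{t_i} for i ≠ m»)] -/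
def fiberG (k : ℕ) (u : Fin k → ℝ) (m : Fin k) (t : ℝ) : ℝ :=
  (profExt k t * psi ((∑ i ∈ univ.erase m, u i) + t)) * ∏ i ∈ univ.erase m, prof k (u i)

/-- `fiberG k u m t = F(u; u_m := t)` for `t ≥ 0`. [cite: Maynard2016DenseClusters, proof of Lemma 9.3 p. 24 (9.29)] -/
theorem fiberG_of_nonneg (hk : 2 ≤ k) (u : Fin k → ℝ) (m : Fin k) {t : ℝ} (ht : 0 ≤ t) :
    fiberG k u m t = F k (Function.update u m t) := by
  rw [F_update_eq, fiberG, profExt_of_nonneg hk ht,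
    show (∑ i ∈ univ.erase m, u i) + t = t + ∑ i ∈ univ.erase m, u i from add_comm _ _]
  ring

/-- **The fibre is an admissible test function for Lemma 8.3**: `C¹` on `ℝ` with
`sup_{[0,1]}(|G| + |G'|) ≤ 31(1 + 30/U_k + T_k)·|∏_{i≠m} g_k(uᵢ)|` (`|ψ| ≤ 1`, `|ψ'| ≤ 30`,
`|profExt| + |profExt'| ≤ 1 + 30/U_k + T_k` on `[0, ∞)`).
[cite: Maynard2016DenseClusters, proof of Lemma 9.3 p. 24 («using Lemma 8.3») with Lemma 8.3 p. 16 (G_max) and (7.4), (8.7)] -/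
theorem fiberG_bounds (hk : 2 ≤ k) (u : Fin k → ℝ) (m : Fin k) :
    ContDiff ℝ 1 (fiberG k u m) ∧
      ∀ t ∈ Set.Icc (0 : ℝ) 1, |fiberG k u m t| + |deriv (fiberG k u m) t| ≤
        31 * (1 + 30 / U k + T k) * |∏ i ∈ univ.erase m, prof k (u i)| := by
  obtain ⟨hcd, hb⟩ := testFn_bounds (contDiff_profExt hk) contDiff_psi
    (fun t ht => abs_profExt_add_abs_deriv_le hk ht.1)
    (fun x => by rw [abs_of_nonneg (psi_nonneg x)]; exact psi_le_one x) abs_deriv_psi_le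
    (∑ i ∈ univ.erase m, u i)
  have hf : fiberG k u m = fun t =>
      (profExt k t * psi ((∑ i ∈ univ.erase m, u i) + t)) * ∏ i ∈ univ.erase m, prof k (u i) := rfl
  refine ⟨by rw [hf]; exact hcd.mul contDiff_const, fun t ht => ?_⟩
  rw [hf, deriv_mul_const_field]
  simp only []
  rw [abs_mul _ (∏ i ∈ univ.erase m, prof k (u i)), abs_mul _ (∏ i ∈ univ.erase m, prof k (u i)),
    ← add_mul]
  have h := hb t ht
  calc (|profExt k t * psi ((∑ i ∈ univ.erase m, u i) + t)| +
          |deriv (fun t => profExt k t * psi ((∑ i ∈ univ.erase m, u i) + t)) t|) *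
        |∏ i ∈ univ.erase m, prof k (u i)|
      ≤ ((1 + 30 / U k + T k) * (1 + 30)) * |∏ i ∈ univ.erase m, prof k (u i)| :=
        mul_le_mul_of_nonneg_right h (abs_nonneg _)
    _ = 31 * (1 + 30 / U k + T k) * |∏ i ∈ univ.erase m, prof k (u i)| := by ring

/-- `∫₀¹ fiberG = ∫₀^∞ F(u; u_m := t) dt` (`g_k = 0` on `[U_k, ∞) ⊇ [1, ∞)`).
[cite: Maynard2016DenseClusters, proof of Lemma 9.3 p. 24, display (9.29) («∫₀^∞ H dt_m»)] -/
theorem intervalIntegral_fiberG (hk : 2 ≤ k) (u : Fin k → ℝ) (m : Fin k) :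
    ∫ x in (0 : ℝ)..1, fiberG k u m x = ∫ t in Set.Ici (0 : ℝ), F k (Function.update u m t) := by
  rw [intervalIntegral_eq_setIntegral_Ici (fun x hx => by
    unfold fiberG; rw [profExt_eq_zero_of_one_le hk hx]; ring)]
  exact MeasureTheory.setIntegral_congr_fun measurableSet_Ici fun t ht => fiberG_of_nonneg hk u m ht

/-- For `k ≥ 2^18`: `31(1 + 30/U_k + T_k) ≤ 93 T_k` (the printed `G_max ≪ T_k`).
[cite: Maynard2016DenseClusters, Lemma 9.3 p. 22 (9.14) (the error O(T_k …)) with proof of Lemma 8.2 (8.7)] -/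
theorem fiber_const_le (hk : 262144 ≤ k) : 31 * (1 + 30 / U k + T k) ≤ 93 * T k := by
  have h := shift_const_le hk
  linarith

end Fiber

/-! ## §4 The `e_m`-summation (display (9.29)) -/

/-- **Lemma 8.3 for the `e_m`-sum, any test function**: there is an absolute `C` such that for `M ≠ 0` divisible
by every prime `p ≤ 2K₀²` (`K₀ ≥ 2`), `ω(p) < p` at every prime and `ω(p) ≤ K₀` at the primes `p ∤ M`,
every `G ∈ C¹(ℝ)` with `|G| + |G'| ≤ G_max` on `[0,1]` and every `R ≥ 2`,
`|∑_{e<R} emWeight(e) G(log e/log R) − c_γ log R ∫₀¹ G| ≤ C c_γ (9 + ∑_{p∣M} log p/p) G_max`.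
[cite: Maynard2016DenseClusters, proof of Lemma 9.3 p. 24, display (9.29) («using Lemma 8.3 we estimate the summation over e_m»), Lemma 8.3 p. 16] -/
theorem emSum_estimate :
    ∃ C : ℝ, ∀ (M : ℕ), M ≠ 0 → ∀ (K₀ : ℝ), 2 ≤ K₀ →
      (∀ p : ℕ, p.Prime → (p : ℝ) ≤ 2 * K₀ ^ 2 → p ∣ M) →
      ∀ (ω : ℕ → ℕ), (∀ p : ℕ, p.Prime → ω p < p) → (∀ p : ℕ, p.Prime → ¬p ∣ M → (ω p : ℝ) ≤ K₀) →
      ∀ (G : ℝ → ℝ), ContDiff ℝ 1 G →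
      ∀ (Gmax : ℝ), (∀ t ∈ Set.Icc (0 : ℝ) 1, |G t| + |deriv G t| ≤ Gmax) →
        ∀ R : ℝ, 2 ≤ R →
          |emSum M ω G R - GGPY.cGamma (emGamma M ω) * Real.log R * ∫ x in (0 : ℝ)..1, G x| ≤
            C * GGPY.cGamma (emGamma M ω) * (9 + ∑ p ∈ M.primeFactors, Real.log p / p) * Gmax := by
  obtain ⟨C, hC⟩ := lemma83_gamma84_dec
  refine ⟨C, fun M hM K₀ hK₀ hsmall ω hω hωK G hG Gmax hGmax R hR => ?_⟩
  have h := hC M hM K₀ (2 * (K₀ - 1)) hK₀ (two_mul_sub_one_le_sq K₀) (fun p => 1 + emA ω p)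
    (emA_hyp hK₀ hωK) hsmall G hG Gmax hGmax R hR
  rw [emSum_eq_smoothedSum hω, emGamma_eq]
  exact h

/-- **Maynard 2016, proof of Lemma 9.3, the `e_m`-summation (9.29)** (from the tree's PROVED Lemma 8.3): there is
an absolute `C` such that for every `k ≥ 2`, `M ≠ 0` divisible by every prime `p ≤ 2K₀²` (`K₀ ≥ 2`; printed
`M = rW_m`, `K₀ = k`), `ω` with `ω(p) < p` at every prime and `ω(p) ≤ K₀` at the primes `p ∤ M`, every
`u ∈ ℝ^k`, `m`, and `R ≥ 2`:
`|∑_{1≤e<R} μ(e)² 1_{(e,M)=1} F_k(u; u_m := log e/log R)/∏_{p∣e} A_ω(p) − c_γ · log R · ∫₀^∞ F_k(u; u_m := t) dt|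
 ≤ C · c_γ · (9 + ∑_{p∣M} log p/p) · 31(1 + 30/U_k + T_k) · |∏_{i≠m} g_k(uᵢ)|`,
where `1/∏_{p∣e}A_ω(p) = 1/(φ_ω(e)∏_{p∣e}(p/(p−1) − 1/φ_ω(p)))` (`emWeight_eq_inv_phi_mul_prod`) and
`c_γ = ∏_{p∣M}(1 − 1/p)∏_{p∤M}(p/(p−1) − 1/φ_ω(p))⁻¹` (`cGammaPartial_emGamma`, `cGamma_mul_lim_emEuler`) — the
printed right side `log R ∏_{p∣rW_m}(1 − 1/p)∏_{p∤rW_m}(p/(p−1) − 1/φ_ω(p))⁻¹ ∫₀^∞ H dt_m` up to the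
normalisation `𝔖_{WB}W^kB^k/φ(WB)^k` of `y` (display (7.7)), with the error `O(c_γ log log R · T_k ∏_{i≠m} g_k(uᵢ))`
explicit (`9 + ∑_{p∣M} log p/p ≪ log log R` by the tree's `sum_primeFactors_log_div_le`).
[cite: Maynard2016DenseClusters, proof of Lemma 9.3 pp. 23–24, display (9.29) (eq. emSummation), with Lemma 8.3 p. 16] -/
theorem emSummation :
    ∃ C : ℝ, ∀ (k : ℕ), 2 ≤ k → ∀ (M : ℕ), M ≠ 0 → ∀ (K₀ : ℝ), 2 ≤ K₀ →
      (∀ p : ℕ, p.Prime → (p : ℝ) ≤ 2 * K₀ ^ 2 → p ∣ M) →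
      ∀ (ω : ℕ → ℕ), (∀ p : ℕ, p.Prime → ω p < p) → (∀ p : ℕ, p.Prime → ¬p ∣ M → (ω p : ℝ) ≤ K₀) →
      ∀ (u : Fin k → ℝ) (m : Fin k) (R : ℝ), 2 ≤ R →
        |emSum M ω (fun t => F k (Function.update u m t)) R -
            GGPY.cGamma (emGamma M ω) * Real.log R * ∫ t in Set.Ici (0 : ℝ), F k (Function.update u m t)| ≤
          C * GGPY.cGamma (emGamma M ω) * (9 + ∑ p ∈ M.primeFactors, Real.log p / p) *
            (31 * (1 + 30 / U k + T k) * |∏ i ∈ univ.erase m, prof k (u i)|) := by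
  obtain ⟨C, hC⟩ := emSum_estimate
  refine ⟨C, fun k hk M hM K₀ hK₀ hsmall ω hω hωK u m R hR => ?_⟩
  obtain ⟨hcd, hb⟩ := fiberG_bounds hk u m
  have h := hC M hM K₀ hK₀ hsmall ω hω hωK (fiberG k u m) hcd _ hb R hR
  rw [intervalIntegral_fiberG hk] at h
  have hsum : emSum M ω (fiberG k u m) R = emSum M ω (fun t => F k (Function.update u m t)) R := by
    unfold emSum
    refine Finset.sum_congr rfl fun e he => ?_
    have he1 : (1 : ℝ) ≤ e := by exact_mod_cast (Finset.mem_Ico.1 he).1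
    rw [fiberG_of_nonneg hk u m (div_nonneg (Real.log_nonneg he1) (Real.log_nonneg (by linarith)))]
  rwa [hsum] at h


/-! ## §5 The profile `h_k = ψ(t/2)/(1 + T_k t)` of `F₂`: sup bounds for the tree's global `C¹` representative `prof₂Ext`
(`Maynard2016DenseClustersMixedProfile.lean` §1: `hasDerivAt_prof₂`, `abs_deriv_prof₂_le`, `prof₂Ext`, `contDiff_prof₂Ext`, …) -/

section ProfTwo

variable {k : ℕ}

/-- `|h_k(t)| + |h_k'(t)| ≤ 16 + T_k` for `t ≥ 0`. [cite: Maynard2016DenseClusters, proof of Lemma 9.3 p. 24 (9.26) with (7.6), (8.7)] -/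
theorem abs_prof₂_add_abs_deriv_le (hk : 2 ≤ k) {t : ℝ} (ht : 0 ≤ t) :
    |prof₂ k t| + |deriv (prof₂ k) t| ≤ 16 + T k := by
  have h1 : |prof₂ k t| ≤ 1 := by
    have h := abs_prof₂Cut_le_one hk t
    rwa [prof₂Cut_of_nonneg ht] at h
  linarith [abs_deriv_prof₂_le hk ht]

/-- `prof₂Ext k t = 0` for `t ≥ 2`. [cite: Maynard2016DenseClusters, proof of Lemma 9.3 p. 24 (9.26) with (7.6)] -/
theorem prof₂Ext_eq_zero_of_two_le {t : ℝ} (ht : 2 ≤ t) : prof₂Ext k t = 0 := by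
  unfold prof₂Ext
  rw [prof₂_eq_zero ht, mul_zero]

/-- `prof₂Ext k ≥ 0`. [cite: Maynard2016DenseClusters, proof of Lemma 9.3 p. 24 (9.26)] -/
theorem prof₂Ext_nonneg (k : ℕ) (t : ℝ) : 0 ≤ prof₂Ext k t := by
  by_cases h : 2 + 4 * T k * t ≤ 0
  · rw [prof₂Ext_of_le h]
  · have hden : 0 < 1 + T k * t := by
      rw [not_le] at h; linarith
    unfold prof₂Ext prof₂
    exact mul_nonneg (Real.smoothTransition.nonneg _) (div_nonneg (psi_nonneg _) hden.le)

/-- `sup_{t ≥ 0}(|prof₂Ext| + |prof₂Ext'|) ≤ 16 + T_k`. [cite: Maynard2016DenseClusters, proof of Lemma 9.3 p. 24 (9.26) with (8.7)] -/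
theorem abs_prof₂Ext_add_abs_deriv_le (hk : 2 ≤ k) {t : ℝ} (ht : 0 ≤ t) :
    |prof₂Ext k t| + |deriv (prof₂Ext k) t| ≤ 16 + T k := by
  rw [prof₂Ext_of_nonneg hk ht, deriv_prof₂Ext_of_nonneg hk ht]
  exact abs_prof₂_add_abs_deriv_le hk ht

/-- `∫₀^∞ prof₂Ext k = ∫ h_k = ell₂ k`. [cite: Maynard2016DenseClusters, proof of Lemma 9.3 p. 24 (9.26) with Lemma 8.6] -/
theorem setIntegral_Ici_prof₂Ext (hk : 2 ≤ k) : ∫ u in Set.Ici (0 : ℝ), prof₂Ext k u = ell₂ k := by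
  rw [← setIntegral_Ici_prof₂]
  exact MeasureTheory.setIntegral_congr_fun measurableSet_Ici fun u hu => prof₂Ext_of_nonneg hk hu

end ProfTwo

/-! ## §6 The `t_m`-fibre of `F₂` and the `e_m`-sum of the error term (9.26) -/

section FiberTwo

variable {k : ℕ}

/-- Updating one coordinate of a point of the orthant by `t ≥ 0` stays in the orthant.
[cite: Maynard2016DenseClusters, proof of Lemma 9.3 p. 24 (9.26) («r' = (r_1,…,e_m,…,r_k)»)] -/
theorem update_mem_orthant {u : Fin k → ℝ} (hu : u ∈ orthant k) (m : Fin k) {t : ℝ} (ht : 0 ≤ t) :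
    Function.update u m t ∈ orthant k := by
  rw [mem_orthant] at hu ⊢
  intro i
  by_cases h : i = m
  · subst h; rw [Function.update_self]; exact ht
  · rw [Function.update_of_ne h]; exact hu i

/-- `F₂(u; u_m := t) = h_k(t) ∏_{i≠m} g_k(uᵢ) + g_k(t) ∑_{j≠m} h_k(u_j) ∏_{i≠j,m} g_k(uᵢ)`.
[cite: Maynard2016DenseClusters, (7.6) (definition of F₂) with proof of Lemma 9.3 p. 24 (9.26)] -/
theorem F₂_update_eq (u : Fin k → ℝ) (m : Fin k) (t : ℝ) :
    F₂ k (Function.update u m t) =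
      prof₂ k t * (∏ i ∈ univ.erase m, prof k (u i)) +
        prof k t * ∑ j ∈ univ.erase m, prof₂ k (u j) * ∏ i ∈ (univ.erase m).erase j, prof k (u i) := by
  unfold F₂
  rw [← Finset.add_sum_erase univ _ (Finset.mem_univ m)]
  simp only [Function.update_self]
  have hA : ∏ i ∈ univ.erase m, prof k (Function.update u m t i) = ∏ i ∈ univ.erase m, prof k (u i) :=
    Finset.prod_congr rfl fun i hi => by rw [Function.update_of_ne (Finset.ne_of_mem_erase hi)]
  rw [hA, Finset.mul_sum]
  congr 1
  refine Finset.sum_congr rfl fun j hj => ?_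
  have hjm : j ≠ m := Finset.ne_of_mem_erase hj
  have hmj : m ∈ univ.erase j := Finset.mem_erase.2 ⟨hjm.symm, Finset.mem_univ m⟩
  have hB : ∏ i ∈ univ.erase j, prof k (Function.update u m t i) =
      prof k t * ∏ i ∈ (univ.erase m).erase j, prof k (u i) := by
    rw [← Finset.mul_prod_erase (univ.erase j) _ hmj, Finset.erase_right_comm (a := j) (b := m)]
    simp only [Function.update_self]
    congr 1
    exact Finset.prod_congr rfl fun i hi => by
      rw [Function.update_of_ne (Finset.ne_of_mem_erase (Finset.mem_of_mem_erase hi))]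
  rw [Function.update_of_ne hjm, hB]
  ring

/-- `F₂(u; u_m := 0) = ∏_{i≠m} g_k(uᵢ) + ∑_{j≠m} h_k(u_j) ∏_{i≠j,m} g_k(uᵢ)` (`g_k(0) = h_k(0) = 1`): the size of the
fibre's coefficients. [cite: Maynard2016DenseClusters, (7.4)–(7.6) with proof of Lemma 9.3 p. 24 (9.26)] -/
theorem F₂_update_zero (u : Fin k → ℝ) (m : Fin k) :
    F₂ k (Function.update u m 0) =
      (∏ i ∈ univ.erase m, prof k (u i)) +
        ∑ j ∈ univ.erase m, prof₂ k (u j) * ∏ i ∈ (univ.erase m).erase j, prof k (u i) := by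
  have h1 : prof k 0 = 1 := by
    unfold prof; rw [zero_div, psi_eq_one (by norm_num)]; simp
  have h2 : prof₂ k 0 = 1 := by
    unfold prof₂; rw [zero_div, psi_eq_one (by norm_num)]; simp
  rw [F₂_update_eq, h1, h2, one_mul, one_mul]

/-- The `t_m`-fibre of `F₂` through `u` as a globally `C¹` function of `t`:
`prof₂Ext k t · ∏_{i≠m} g_k(uᵢ) + profExt k t · ∑_{j≠m} h_k(u_j) ∏_{i≠j,m} g_k(uᵢ)` (`= F₂(u; u_m := t)` for `t ≥ 0`).
[cite: Maynard2016DenseClusters, proof of Lemma 9.3 p. 24, display (9.26) (∑_{e_m} Y_{r'}/φ_ω(e_m), Y built from F₂ (8.5))] -/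
def fiberG₂ (k : ℕ) (u : Fin k → ℝ) (m : Fin k) (t : ℝ) : ℝ :=
  prof₂Ext k t * (∏ i ∈ univ.erase m, prof k (u i)) +
    profExt k t * ∑ j ∈ univ.erase m, prof₂ k (u j) * ∏ i ∈ (univ.erase m).erase j, prof k (u i)

/-- `fiberG₂ k u m t = F₂(u; u_m := t)` for `t ≥ 0`. [cite: Maynard2016DenseClusters, proof of Lemma 9.3 p. 24 (9.26)] -/
theorem fiberG₂_of_nonneg (hk : 2 ≤ k) (u : Fin k → ℝ) (m : Fin k) {t : ℝ} (ht : 0 ≤ t) :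
    fiberG₂ k u m t = F₂ k (Function.update u m t) := by
  rw [F₂_update_eq, fiberG₂, prof₂Ext_of_nonneg hk ht, profExt_of_nonneg hk ht]

/-- **The `F₂`-fibre is an admissible test function for Lemma 8.3**: `C¹` on `ℝ` with
`sup_{[0,1]}(|G| + |G'|) ≤ (16 + 30/U_k + T_k) · F₂(u; u_m := 0)` for `u` in the orthant.
[cite: Maynard2016DenseClusters, proof of Lemma 9.3 p. 24, display (9.26) with Lemma 8.3 p. 16 (G_max), (8.7)] -/
theorem fiberG₂_bounds (hk : 2 ≤ k) {u : Fin k → ℝ} (hu : u ∈ orthant k) (m : Fin k) :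
    ContDiff ℝ 1 (fiberG₂ k u m) ∧
      ∀ t ∈ Set.Icc (0 : ℝ) 1, |fiberG₂ k u m t| + |deriv (fiberG₂ k u m) t| ≤
        (16 + 30 / U k + T k) * F₂ k (Function.update u m 0) := by
  set α := ∏ i ∈ univ.erase m, prof k (u i) with hα
  set β := ∑ j ∈ univ.erase m, prof₂ k (u j) * ∏ i ∈ (univ.erase m).erase j, prof k (u i) with hβ
  have hα0 : 0 ≤ α := Finset.prod_nonneg fun i _ => prof_nonneg hk (mem_orthant.1 hu i)
  have hβ0 : 0 ≤ β := Finset.sum_nonneg fun j _ => mul_nonneg (prof₂_nonneg hk (mem_orthant.1 hu j))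
    (Finset.prod_nonneg fun i _ => prof_nonneg hk (mem_orthant.1 hu i))
  have h2 : ContDiff ℝ 1 (prof₂Ext k) := contDiff_prof₂Ext hk
  have h1 : ContDiff ℝ 1 (profExt k) := contDiff_profExt hk
  have hf : fiberG₂ k u m = fun t => prof₂Ext k t * α + profExt k t * β := rfl
  have hcd : ContDiff ℝ 1 (fiberG₂ k u m) := by
    rw [hf]; exact (h2.mul contDiff_const).add (h1.mul contDiff_const)
  refine ⟨hcd, fun t ht => ?_⟩
  have hd2 : DifferentiableAt ℝ (prof₂Ext k) t := (h2.differentiable (by simp)).differentiableAt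
  have hd1 : DifferentiableAt ℝ (profExt k) t := (h1.differentiable (by simp)).differentiableAt
  have hderiv : deriv (fiberG₂ k u m) t = deriv (prof₂Ext k) t * α + deriv (profExt k) t * β := by
    rw [hf, deriv_fun_add (hd2.mul_const _) (hd1.mul_const _), deriv_mul_const_field, deriv_mul_const_field]
  have hval : fiberG₂ k u m t = prof₂Ext k t * α + profExt k t * β := rfl
  rw [hderiv, hval, F₂_update_zero u m, ← hα, ← hβ]
  have hb2 := abs_prof₂Ext_add_abs_deriv_le hk ht.1
  have hb1 := abs_profExt_add_abs_deriv_le hk ht.1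
  have hk1 : 1 ≤ k := le_trans (by norm_num) hk
  have hU : 0 < 30 / U k := by have := U_pos hk1; positivity
  calc |prof₂Ext k t * α + profExt k t * β| + |deriv (prof₂Ext k) t * α + deriv (profExt k) t * β|
      ≤ (|prof₂Ext k t * α| + |profExt k t * β|) +
          (|deriv (prof₂Ext k) t * α| + |deriv (profExt k) t * β|) :=
        add_le_add (abs_add_le _ _) (abs_add_le _ _)
    _ = (|prof₂Ext k t| + |deriv (prof₂Ext k) t|) * α + (|profExt k t| + |deriv (profExt k) t|) * β := by
        rw [abs_mul, abs_mul, abs_mul, abs_mul, abs_of_nonneg hα0, abs_of_nonneg hβ0]; ring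
    _ ≤ (16 + T k) * α + (1 + 30 / U k + T k) * β :=
        add_le_add (mul_le_mul_of_nonneg_right hb2 hα0) (mul_le_mul_of_nonneg_right hb1 hβ0)
    _ ≤ (16 + 30 / U k + T k) * (α + β) := by nlinarith [mul_nonneg hU.le hα0]

/-- `t ↦ F₂(u; u_m := t)` is integrable on `[0, ∞)`. [cite: Maynard2016DenseClusters, proof of Lemma 9.3 p. 24 (9.26) («∫₀^∞ F₂ dt_m»)] -/
theorem integrableOn_F₂_update (hk : 2 ≤ k) (u : Fin k → ℝ) (m : Fin k) :
    MeasureTheory.IntegrableOn (fun t => F₂ k (Function.update u m t)) (Set.Ici 0) := by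
  have hI2 : MeasureTheory.IntegrableOn (prof₂ k) (Set.Ici 0) := by
    have h := integrable_prof₂Cut hk
    rwa [prof₂Cut, MeasureTheory.integrable_indicator_iff measurableSet_Ici] at h
  have hI1 : MeasureTheory.IntegrableOn (prof k) (Set.Ici 0) := by
    have h := integrable_profCut hk
    rwa [profCut, MeasureTheory.integrable_indicator_iff measurableSet_Ici] at h
  have h : MeasureTheory.IntegrableOn (fun t => prof₂ k t * (∏ i ∈ univ.erase m, prof k (u i)) +
      prof k t * ∑ j ∈ univ.erase m, prof₂ k (u j) * ∏ i ∈ (univ.erase m).erase j, prof k (u i))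
      (Set.Ici 0) :=
    (hI2.mul_const (∏ i ∈ univ.erase m, prof k (u i))).add
      (hI1.mul_const (∑ j ∈ univ.erase m, prof₂ k (u j) * ∏ i ∈ (univ.erase m).erase j, prof k (u i)))
  exact h.congr_fun (fun t _ => (F₂_update_eq u m t).symm) measurableSet_Ici

/-- `∫₀^∞ F₂(u; u_m := t) dt = (∫ h_k) ∏_{i≠m} g_k(uᵢ) + L_k ∑_{j≠m} h_k(u_j) ∏_{i≠j,m} g_k(uᵢ)`.
[cite: Maynard2016DenseClusters, proof of Lemma 9.3 p. 24 (9.26) («∫₀^∞ F₂ dt_m») with Lemma 8.6] -/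
theorem setIntegral_Ici_F₂_update (hk : 2 ≤ k) (u : Fin k → ℝ) (m : Fin k) :
    ∫ t in Set.Ici (0 : ℝ), F₂ k (Function.update u m t) =
      ell₂ k * (∏ i ∈ univ.erase m, prof k (u i)) +
        ell k * ∑ j ∈ univ.erase m, prof₂ k (u j) * ∏ i ∈ (univ.erase m).erase j, prof k (u i) := by
  have hI2 : MeasureTheory.IntegrableOn (prof₂ k) (Set.Ici 0) := by
    have h := integrable_prof₂Cut hk
    rwa [prof₂Cut, MeasureTheory.integrable_indicator_iff measurableSet_Ici] at h
  have hI1 : MeasureTheory.IntegrableOn (prof k) (Set.Ici 0) := by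
    have h := integrable_profCut hk
    rwa [profCut, MeasureTheory.integrable_indicator_iff measurableSet_Ici] at h
  simp_rw [F₂_update_eq]
  rw [MeasureTheory.integral_add (hI2.mul_const _) (hI1.mul_const _), MeasureTheory.integral_mul_const,
    MeasureTheory.integral_mul_const, setIntegral_Ici_prof, setIntegral_Ici_prof₂]

/-- `F₂(u; u_m := 0) · L_k ≤ ∫₀^∞ F₂(u; u_m := t) dt` for `u` in the orthant (`L_k ≤ ∫ h_k`): the sup of the fibre
against its integral (printed: `G_max ≪ T_k`, `∫ g_k ≫ log k/T_k`).
[cite: Maynard2016DenseClusters, proof of Lemma 9.3 p. 24 (9.26) with Lemma 8.6 p. 18] -/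
theorem F₂_update_zero_mul_ell_le (hk : 2 ≤ k) {u : Fin k → ℝ} (hu : u ∈ orthant k) (m : Fin k) :
    F₂ k (Function.update u m 0) * ell k ≤ ∫ t in Set.Ici (0 : ℝ), F₂ k (Function.update u m t) := by
  rw [F₂_update_zero u m, setIntegral_Ici_F₂_update hk u m]
  have hα0 : 0 ≤ ∏ i ∈ univ.erase m, prof k (u i) :=
    Finset.prod_nonneg fun i _ => prof_nonneg hk (mem_orthant.1 hu i)
  have hβ0 : 0 ≤ ∑ j ∈ univ.erase m, prof₂ k (u j) * ∏ i ∈ (univ.erase m).erase j, prof k (u i) :=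
    Finset.sum_nonneg fun j _ => mul_nonneg (prof₂_nonneg hk (mem_orthant.1 hu j))
      (Finset.prod_nonneg fun i _ => prof_nonneg hk (mem_orthant.1 hu i))
  nlinarith [mul_le_mul_of_nonneg_left (ell_le_ell₂ hk) hα0]

/-- `∫₀¹ fiberG₂ ≤ ∫₀^∞ F₂(u; u_m := t) dt` for `u` in the orthant (the fibre is `≥ 0` beyond `1`).
[cite: Maynard2016DenseClusters, proof of Lemma 9.3 p. 24, display (9.26) («∫₀^∞ F₂ dt_m»)] -/
theorem intervalIntegral_fiberG₂_le (hk : 2 ≤ k) {u : Fin k → ℝ} (hu : u ∈ orthant k) (m : Fin k) :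
    ∫ x in (0 : ℝ)..1, fiberG₂ k u m x ≤ ∫ t in Set.Ici (0 : ℝ), F₂ k (Function.update u m t) := by
  rw [intervalIntegral.integral_of_le zero_le_one]
  calc ∫ x in Set.Ioc (0 : ℝ) 1, fiberG₂ k u m x
      = ∫ x in Set.Ioc (0 : ℝ) 1, F₂ k (Function.update u m x) :=
        MeasureTheory.setIntegral_congr_fun measurableSet_Ioc fun x hx => fiberG₂_of_nonneg hk u m hx.1.le
    _ ≤ ∫ t in Set.Ici (0 : ℝ), F₂ k (Function.update u m t) :=
        MeasureTheory.setIntegral_mono_set (integrableOn_F₂_update hk u m)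
          (MeasureTheory.ae_restrict_of_forall_mem measurableSet_Ici fun t ht =>
            F₂_nonneg hk (update_mem_orthant hu m ht))
          (Set.Ioc_subset_Ioi_self.trans Set.Ioi_subset_Ici_self).eventuallyLE

/-- **The `e_m`-sum of the error term (9.26), upper bound** (from the tree's PROVED Lemma 8.3): there is an absolute
`C ≥ 0` such that, under the hypotheses of `emSummation` and for `u` in the orthant,
`∑_{1≤e<R} μ(e)² 1_{(e,M)=1} F₂(u; u_m := log e/log R)/∏_{p∣e} A_ω(p)
 ≤ c_γ log R ∫₀^∞ F₂(u; u_m := t) dt + C c_γ (9 + ∑_{p∣M} log p/p)(16 + 30/U_k + T_k) F₂(u; u_m := 0)`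
(printed: «using Lemma 8.4 to estimate the sum over e_m, we see the error contributes
≪ … ∫₀^∞ F₂ dt_m»; `F₂(u; u_m := 0) L_k ≤ ∫₀^∞ F₂ dt_m`, `F₂_update_zero_mul_ell_le`).
[cite: Maynard2016DenseClusters, proof of Lemma 9.3 p. 24, display (9.26) (eq. YmError) with Lemma 8.3 p. 16] -/
theorem emSum_F₂_le :
    ∃ C : ℝ, 0 ≤ C ∧ ∀ (k : ℕ), 2 ≤ k → ∀ (M : ℕ), M ≠ 0 → ∀ (K₀ : ℝ), 2 ≤ K₀ →
      (∀ p : ℕ, p.Prime → (p : ℝ) ≤ 2 * K₀ ^ 2 → p ∣ M) →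
      ∀ (ω : ℕ → ℕ), (∀ p : ℕ, p.Prime → ω p < p) → (∀ p : ℕ, p.Prime → ¬p ∣ M → (ω p : ℝ) ≤ K₀) →
      ∀ (u : Fin k → ℝ), u ∈ orthant k → ∀ (m : Fin k) (R : ℝ), 2 ≤ R →
        emSum M ω (fun t => F₂ k (Function.update u m t)) R ≤
          GGPY.cGamma (emGamma M ω) * Real.log R * (∫ t in Set.Ici (0 : ℝ), F₂ k (Function.update u m t)) +
            C * GGPY.cGamma (emGamma M ω) * (9 + ∑ p ∈ M.primeFactors, Real.log p / p) *
              ((16 + 30 / U k + T k) * F₂ k (Function.update u m 0)) := by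
  obtain ⟨C, hC⟩ := emSum_estimate
  refine ⟨max C 0, le_max_right _ _, fun k hk M hM K₀ hK₀ hsmall ω hω hωK u hu m R hR => ?_⟩
  obtain ⟨hcd, hb⟩ := fiberG₂_bounds hk hu m
  have h := hC M hM K₀ hK₀ hsmall ω hω hωK (fiberG₂ k u m) hcd _ hb R hR
  have hsum : emSum M ω (fiberG₂ k u m) R = emSum M ω (fun t => F₂ k (Function.update u m t)) R := by
    unfold emSum
    refine Finset.sum_congr rfl fun e he => ?_
    have he1 : (1 : ℝ) ≤ e := by exact_mod_cast (Finset.mem_Ico.1 he).1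
    rw [fiberG₂_of_nonneg hk u m (div_nonneg (Real.log_nonneg he1) (Real.log_nonneg (by linarith)))]
  rw [hsum] at h
  have hc : 0 < GGPY.cGamma (emGamma M ω) := cGamma_emGamma_pos hM hK₀ hsmall hωK
  have hlogR : 0 ≤ Real.log R := Real.log_nonneg (by linarith)
  have hint := intervalIntegral_fiberG₂_le hk hu m
  have hL : 0 ≤ 9 + ∑ p ∈ M.primeFactors, Real.log p / p := by
    have : 0 ≤ ∑ p ∈ M.primeFactors, Real.log p / p := Finset.sum_nonneg fun p hp => by
      have := (Nat.prime_of_mem_primeFactors hp).pos; positivity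
    linarith
  have hk1 : 1 ≤ k := le_trans (by norm_num) hk
  have hU := U_pos hk1
  have hT := T_pos hk
  have hG : 0 ≤ (16 + 30 / U k + T k) * F₂ k (Function.update u m 0) :=
    mul_nonneg (by positivity) (F₂_nonneg hk (update_mem_orthant hu m le_rfl))
  have hX : 0 ≤ GGPY.cGamma (emGamma M ω) * (9 + ∑ p ∈ M.primeFactors, Real.log p / p) *
      ((16 + 30 / U k + T k) * F₂ k (Function.update u m 0)) := mul_nonneg (mul_nonneg hc.le hL) hG
  have h1 := (abs_le.1 h).2
  have h3 : C * (GGPY.cGamma (emGamma M ω) * (9 + ∑ p ∈ M.primeFactors, Real.log p / p) *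
      ((16 + 30 / U k + T k) * F₂ k (Function.update u m 0))) ≤
      max C 0 * (GGPY.cGamma (emGamma M ω) * (9 + ∑ p ∈ M.primeFactors, Real.log p / p) *
        ((16 + 30 / U k + T k) * F₂ k (Function.update u m 0))) :=
    mul_le_mul_of_nonneg_right (le_max_left _ _) hX
  have h4 : GGPY.cGamma (emGamma M ω) * Real.log R * (∫ x in (0 : ℝ)..1, fiberG₂ k u m x) ≤
      GGPY.cGamma (emGamma M ω) * Real.log R * ∫ t in Set.Ici (0 : ℝ), F₂ k (Function.update u m t) :=
    mul_le_mul_of_nonneg_left hint (mul_nonneg hc.le hlogR)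
  linarith [h1, h3, h4]

end FiberTwo

/-! ## §7 Quantitative (9.30): `c_γ · ∏_{p<y, p∤M}(p/(p−1) − 1/φ_ω(p)) = (1 + O(K₀/y)) φ(M)/M` -/

section Quantitative

/-- `(p/(p−1) − 1/φ_ω(p))⁻¹ − 1 = (ω(p) − 1)/(p φ_ω(p) − (p − 1))` at a prime with `ω(p) < p`.
[cite: Maynard2016DenseClusters, proof of Lemma 9.3 p. 24, displays (9.28)–(9.30)] -/
theorem emFactor_inv_sub_one (ω : ℕ → ℕ) {p : ℕ} (hp : p.Prime) (hω : ω p < p) :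
    ((p : ℝ) / ((p : ℝ) - 1) - 1 / ((p : ℝ) - ω p))⁻¹ - 1 =
      ((ω p : ℝ) - 1) / ((p : ℝ) * ((p : ℝ) - ω p) - ((p : ℝ) - 1)) := by
  have h2 : (2 : ℝ) ≤ p := by exact_mod_cast hp.two_le
  have hp1 : (p : ℝ) - 1 ≠ 0 := by
    have : 0 < (p : ℝ) - 1 := by linarith
    exact this.ne'
  have hω1 : (ω p : ℝ) + 1 ≤ p := by exact_mod_cast Nat.succ_le_of_lt hω
  have hφ : (p : ℝ) - ω p ≠ 0 := by
    have : 0 < (p : ℝ) - ω p := by linarith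
    exact this.ne'
  have hD : (p : ℝ) * ((p : ℝ) - ω p) - ((p : ℝ) - 1) ≠ 0 := by
    have : 0 < (p : ℝ) * ((p : ℝ) - ω p) - ((p : ℝ) - 1) := by nlinarith
    exact this.ne'
  have e2 : (p : ℝ) / ((p : ℝ) - 1) - 1 / ((p : ℝ) - ω p) =
      ((p : ℝ) * ((p : ℝ) - ω p) - ((p : ℝ) - 1)) / (((p : ℝ) - 1) * ((p : ℝ) - ω p)) := by
    field_simp
  rw [e2, inv_div, div_sub_one hD, div_left_inj' hD]
  ring

/-- **`|(p/(p−1) − 1/φ_ω(p))⁻¹ − 1| ≤ 2K₀/p²`** at a prime `p > 2K₀²` with `ω(p) ≤ K₀`, `K₀ ≥ 2`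
(`|ω(p) − 1| ≤ K₀`, `p φ_ω(p) − (p−1) ≥ p² − (K₀+1)p ≥ p²/2`).
[cite: Maynard2016DenseClusters, proof of Lemma 9.3 p. 24, displays (9.28)–(9.30) («only involve primes p > 2k²»)] -/
theorem abs_emFactor_inv_sub_one_le (ω : ℕ → ℕ) {p : ℕ} (hp : p.Prime) {K₀ : ℝ} (hK₀ : 2 ≤ K₀)
    (hωK : (ω p : ℝ) ≤ K₀) (hpK : 2 * K₀ ^ 2 < p) :
    |((p : ℝ) / ((p : ℝ) - 1) - 1 / ((p : ℝ) - ω p))⁻¹ - 1| ≤ 2 * K₀ / (p : ℝ) ^ 2 := by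
  have hω0 : (0 : ℝ) ≤ ω p := Nat.cast_nonneg _
  have hK2 : 2 * K₀ + 2 ≤ 2 * K₀ ^ 2 := by nlinarith
  have hpK' : 2 * K₀ + 2 < (p : ℝ) := lt_of_le_of_lt hK2 hpK
  have hωp : (ω p : ℝ) < p := by linarith
  have hω : ω p < p := by exact_mod_cast hωp
  rw [emFactor_inv_sub_one ω hp hω]
  have hD : (p : ℝ) ^ 2 / 2 ≤ (p : ℝ) * ((p : ℝ) - ω p) - ((p : ℝ) - 1) := by nlinarith
  have hp0 : (0 : ℝ) < p := by linarith
  have hD0 : 0 < (p : ℝ) * ((p : ℝ) - ω p) - ((p : ℝ) - 1) := lt_of_lt_of_le (by positivity) hD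
  rw [abs_div, abs_of_pos hD0, div_le_div_iff₀ hD0 (by positivity)]
  have habs : |(ω p : ℝ) - 1| ≤ K₀ := by
    rw [abs_le]; constructor <;> linarith
  calc |(ω p : ℝ) - 1| * (p : ℝ) ^ 2 ≤ K₀ * (p : ℝ) ^ 2 := by gcongr
    _ = 2 * K₀ * ((p : ℝ) ^ 2 / 2) := by ring
    _ ≤ 2 * K₀ * ((p : ℝ) * ((p : ℝ) - ω p) - ((p : ℝ) - 1)) := by gcongr

/-- `|∏_{i∈S}(1 + δᵢ) − 1| ≤ exp(∑_{i∈S} uᵢ) − 1` when `|δᵢ| ≤ uᵢ`. [folklore] -/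
private theorem abs_prod_one_add_sub_one_le_exp {ι : Type*} (S : Finset ι) {δ u : ι → ℝ}
    (h : ∀ i ∈ S, |δ i| ≤ u i) :
    |∏ i ∈ S, (1 + δ i) - 1| ≤ Real.exp (∑ i ∈ S, u i) - 1 := by
  classical
  induction S using Finset.induction_on with
  | empty => simp
  | insert a S ha ih =>
    have hS : ∀ i ∈ S, |δ i| ≤ u i := fun i hi => h i (Finset.mem_insert_of_mem hi)
    have hih := ih hS
    have hda := h a (Finset.mem_insert_self a S)
    have hua : 0 ≤ u a := (abs_nonneg _).trans hda
    rw [Finset.prod_insert ha, Finset.sum_insert ha, Real.exp_add]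
    set P := ∏ i ∈ S, (1 + δ i) with hP
    set E := Real.exp (∑ i ∈ S, u i) with hE
    have hE1 : 1 ≤ E := by
      rw [hE]; exact Real.one_le_exp (Finset.sum_nonneg fun i hi => (abs_nonneg _).trans (hS i hi))
    have hPabs : |P| ≤ E := by
      have := abs_sub_abs_le_abs_sub P 1
      rw [abs_one] at this
      linarith
    have hexp : 1 + u a ≤ Real.exp (u a) := by linarith [Real.add_one_le_exp (u a)]
    calc |(1 + δ a) * P - 1| = |δ a * P + (P - 1)| := by ring_nf
      _ ≤ |δ a * P| + |P - 1| := abs_add_le _ _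
      _ = |δ a| * |P| + |P - 1| := by rw [abs_mul]
      _ ≤ u a * E + (E - 1) := add_le_add (mul_le_mul hda hPabs (abs_nonneg _) hua) hih
      _ = (1 + u a) * E - 1 := by ring
      _ ≤ Real.exp (u a) * E - 1 := by nlinarith

/-- `∑_{k ∈ S} 1/k² ≤ 1/(y − 1)` when every element of `S` is `≥ y ≥ 2` (telescoping `1/k² ≤ 1/(k−1) − 1/k`). [folklore] -/
private theorem sum_inv_sq_le_of_le (S : Finset ℕ) {y : ℕ} (hy : 2 ≤ y) (hS : ∀ k ∈ S, y ≤ k) :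
    ∑ k ∈ S, 1 / (k : ℝ) ^ 2 ≤ 1 / ((y : ℝ) - 1) := by
  have hy' : (2 : ℝ) ≤ y := by exact_mod_cast hy
  have hpt : ∀ k : ℕ, 2 ≤ k → 1 / (k : ℝ) ^ 2 ≤ 1 / ((k : ℝ) - 1) - 1 / k := by
    intro k hk
    have hk' : (2 : ℝ) ≤ k := by exact_mod_cast hk
    rw [div_sub_div _ _ (by linarith) (by linarith), div_le_div_iff₀ (by positivity) (by nlinarith)]
    nlinarith
  have htel : ∀ N : ℕ, y ≤ N →
      ∑ k ∈ Finset.Ico y N, (1 / ((k : ℝ) - 1) - 1 / k) = 1 / ((y : ℝ) - 1) - 1 / ((N : ℝ) - 1) := by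
    intro N hN
    induction N, hN using Nat.le_induction with
    | base => simp
    | succ N hyN ih =>
      rw [Finset.sum_Ico_succ_top hyN, ih]
      have hN1 : (N : ℝ) - 1 ≠ 0 := by
        have : (2 : ℝ) ≤ N := by exact_mod_cast le_trans hy hyN
        have : 0 < (N : ℝ) - 1 := by linarith
        exact this.ne'
      push_cast
      ring
  rcases S.eq_empty_or_nonempty with rfl | hne
  · simp only [Finset.sum_empty]
    exact div_nonneg zero_le_one (by linarith)
  set N := S.max' hne
  have hyN : y ≤ N + 1 := le_trans (hS _ (Finset.max'_mem S hne)) (Nat.le_succ _)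
  have hsub : S ⊆ Finset.Ico y (N + 1) := fun k hk =>
    Finset.mem_Ico.2 ⟨hS k hk, Nat.lt_succ_of_le (Finset.le_max' S k hk)⟩
  have hN0 : 0 ≤ 1 / (((N + 1 : ℕ) : ℝ) - 1) := by
    push_cast
    have : (0 : ℝ) ≤ N := Nat.cast_nonneg _
    exact div_nonneg zero_le_one (by linarith)
  calc ∑ k ∈ S, 1 / (k : ℝ) ^ 2 ≤ ∑ k ∈ Finset.Ico y (N + 1), 1 / (k : ℝ) ^ 2 :=
        Finset.sum_le_sum_of_subset_of_nonneg hsub fun k _ _ => by positivity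
    _ ≤ ∑ k ∈ Finset.Ico y (N + 1), (1 / ((k : ℝ) - 1) - 1 / k) :=
        Finset.sum_le_sum fun k hk => hpt k (le_trans hy (Finset.mem_Ico.1 hk).1)
    _ = 1 / ((y : ℝ) - 1) - 1 / (((N + 1 : ℕ) : ℝ) - 1) := htel (N + 1) hyN
    _ ≤ 1 / ((y : ℝ) - 1) := by linarith

/-- The Euler factors of (9.28) over the primes in `[y, Y)` not dividing `M`.
[cite: Maynard2016DenseClusters, proof of Lemma 9.3 p. 24, displays (9.28)–(9.30)] -/
def emEulerIco (M : ℕ) (ω : ℕ → ℕ) (y Y : ℕ) : ℝ :=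
  ∏ p ∈ (Finset.Ico y Y).filter (fun p => p.Prime ∧ ¬p ∣ M),
    ((p : ℝ) / ((p : ℝ) - 1) - 1 / ((p : ℝ) - ω p))

/-- Splitting the partial product at `y ≤ Y`: `emEuler M ω Y = emEuler M ω y · emEulerIco M ω y Y`.
[cite: Maynard2016DenseClusters, proof of Lemma 9.3 p. 24, displays (9.28)–(9.30)] -/
theorem emEuler_eq_mul_emEulerIco (M : ℕ) (ω : ℕ → ℕ) {y Y : ℕ} (hyY : y ≤ Y) :
    emEuler M ω Y = emEuler M ω y * emEulerIco M ω y Y := by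
  unfold emEuler emEulerIco
  rw [← Finset.prod_union]
  · congr 1
    ext p
    simp only [Finset.mem_filter, Nat.mem_primesBelow, Finset.mem_union, Finset.mem_Ico]
    constructor
    · rintro ⟨⟨hpY, hp⟩, hM⟩
      by_cases h : p < y
      · exact Or.inl ⟨⟨h, hp⟩, hM⟩
      · exact Or.inr ⟨⟨not_lt.1 h, hpY⟩, hp, hM⟩
    · rintro (⟨⟨hpy, hp⟩, hM⟩ | ⟨⟨hyp, hpY⟩, hp, hM⟩)
      · exact ⟨⟨lt_of_lt_of_le hpy hyY, hp⟩, hM⟩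
      · exact ⟨⟨hpY, hp⟩, hM⟩
  · rw [Finset.disjoint_left]
    rintro p hp hp'
    have h1 := (Nat.mem_primesBelow.1 (Finset.mem_filter.1 hp).1).1
    have h2 := (Finset.mem_Ico.1 (Finset.mem_filter.1 hp').1).1
    omega

/-- `|emEulerIco⁻¹ − 1| ≤ exp(2K₀/(y − 1)) − 1` for `y > 2K₀²` (every factor is within `2K₀/p²` of `1` after
inversion, and `∑_{p ≥ y} 1/p² ≤ 1/(y−1)`).
[cite: Maynard2016DenseClusters, proof of Lemma 9.3 p. 24, displays (9.28)–(9.30)] -/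
theorem abs_inv_emEulerIco_sub_one_le {M : ℕ} {ω : ℕ → ℕ} {K₀ : ℝ} (hK₀ : 2 ≤ K₀)
    (hωK : ∀ p : ℕ, p.Prime → ¬p ∣ M → (ω p : ℝ) ≤ K₀) {y Y : ℕ} (hy : 2 * K₀ ^ 2 < y) :
    |(emEulerIco M ω y Y)⁻¹ - 1| ≤ Real.exp (2 * K₀ / ((y : ℝ) - 1)) - 1 := by
  have hy8 : (8 : ℝ) < y := lt_of_le_of_lt (by nlinarith) hy
  have hy2 : 2 ≤ y := by exact_mod_cast (show (2 : ℝ) ≤ y by linarith)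
  unfold emEulerIco
  rw [← Finset.prod_inv_distrib]
  set S := (Finset.Ico y Y).filter (fun p => p.Prime ∧ ¬p ∣ M) with hSdef
  have hmem : ∀ p ∈ S, p.Prime ∧ ¬p ∣ M ∧ y ≤ p := fun p hp => by
    have h := Finset.mem_filter.1 hp
    exact ⟨h.2.1, h.2.2, (Finset.mem_Ico.1 h.1).1⟩
  have hprod : ∏ p ∈ S, ((p : ℝ) / ((p : ℝ) - 1) - 1 / ((p : ℝ) - ω p))⁻¹ =
      ∏ p ∈ S, (1 + ((((p : ℝ) / ((p : ℝ) - 1) - 1 / ((p : ℝ) - ω p))⁻¹ - 1))) :=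
    Finset.prod_congr rfl fun p _ => by ring
  rw [hprod]
  refine (abs_prod_one_add_sub_one_le_exp S (u := fun p => 2 * K₀ / (p : ℝ) ^ 2) fun p hp => ?_).trans ?_
  · obtain ⟨hpr, hpM, hyp⟩ := hmem p hp
    have hyp' : (y : ℝ) ≤ p := by exact_mod_cast hyp
    exact abs_emFactor_inv_sub_one_le ω hpr hK₀ (hωK p hpr hpM) (lt_of_lt_of_le hy hyp')
  · have hsum : ∑ p ∈ S, 2 * K₀ / (p : ℝ) ^ 2 ≤ 2 * K₀ / ((y : ℝ) - 1) := by
      rw [show ∑ p ∈ S, 2 * K₀ / (p : ℝ) ^ 2 = 2 * K₀ * ∑ p ∈ S, 1 / (p : ℝ) ^ 2 by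
        rw [Finset.mul_sum]; exact Finset.sum_congr rfl fun p _ => by ring]
      rw [show 2 * K₀ / ((y : ℝ) - 1) = 2 * K₀ * (1 / ((y : ℝ) - 1)) by ring]
      exact mul_le_mul_of_nonneg_left (sum_inv_sq_le_of_le S hy2 fun p hp => (hmem p hp).2.2)
        (by linarith)
    linarith [Real.exp_le_exp.2 hsum]

/-- **Quantitative (9.30)**: for `y > 2K₀²`,
`|c_γ · ∏_{p<y, p∤M}(p/(p−1) − 1/φ_ω(p)) − φ(M)/M| ≤ (exp(2K₀/(y−1)) − 1) · φ(M)/M`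
(`c_γ = lim_Y c_γ(Y)`, `c_γ(Y) emEuler(Y) = ∏_{p<Y,p∣M}(1 − 1/p) = φ(M)/M` for `Y > M`, and
`emEuler(Y) = emEuler(y) · emEulerIco(y, Y)`).
[cite: Maynard2016DenseClusters, proof of Lemma 9.3 p. 24, displays (9.28)–(9.30)] -/
theorem abs_cGamma_mul_emEuler_sub_le {M : ℕ} (hM : M ≠ 0) {K₀ : ℝ} (hK₀ : 2 ≤ K₀)
    (hsmall : ∀ p : ℕ, p.Prime → (p : ℝ) ≤ 2 * K₀ ^ 2 → p ∣ M) {ω : ℕ → ℕ}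
    (hωK : ∀ p : ℕ, p.Prime → ¬p ∣ M → (ω p : ℝ) ≤ K₀) (hω : ∀ p : ℕ, p.Prime → ¬p ∣ M → ω p < p)
    {y : ℕ} (hy : 2 * K₀ ^ 2 < y) :
    |GGPY.cGamma (emGamma M ω) * emEuler M ω y - (Nat.totient M : ℝ) / M| ≤
      (Real.exp (2 * K₀ / ((y : ℝ) - 1)) - 1) * ((Nat.totient M : ℝ) / M) := by
  have hc := tendsto_cGammaPartial_emGamma hM hK₀ hsmall hωK
  -- the limit of `c_γ(Y) · emEuler(y)`
  have hlim : Tendsto (fun Y => GGPY.cGammaPartial (emGamma M ω) Y * emEuler M ω y) atTop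
      (𝓝 (GGPY.cGamma (emGamma M ω) * emEuler M ω y)) := hc.mul_const _
  have hlim' : Tendsto (fun Y => |GGPY.cGammaPartial (emGamma M ω) Y * emEuler M ω y -
      (Nat.totient M : ℝ) / M|) atTop
      (𝓝 |GGPY.cGamma (emGamma M ω) * emEuler M ω y - (Nat.totient M : ℝ) / M|) :=
    (hlim.sub_const _).abs
  refine le_of_tendsto hlim' (Filter.eventually_atTop.2 ⟨max (M + 1) y, fun Y hY => ?_⟩)
  have hYM : M < Y := by have := le_max_left (M + 1) y; omega
  have hyY : y ≤ Y := le_trans (le_max_right _ _) hY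
  -- the factors of `emEulerIco` are positive, so it is invertible
  have hIpos : 0 < emEulerIco M ω y Y := by
    unfold emEulerIco
    exact Finset.prod_pos fun p hp => by
      have h := (Finset.mem_filter.1 hp).2
      exact emFactor_pos ω h.1 (hω p h.1 h.2)
  have hkey : GGPY.cGammaPartial (emGamma M ω) Y * emEuler M ω y =
      (Nat.totient M : ℝ) / M * (emEulerIco M ω y Y)⁻¹ := by
    have h := cGammaPartial_mul_emEuler hM hω hYM
    rw [emEuler_eq_mul_emEulerIco M ω hyY, ← mul_assoc] at h
    rw [prod_primeFactors_one_sub_inv hM] at h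
    rw [← h, mul_assoc, mul_inv_cancel₀ hIpos.ne', mul_one]
  rw [hkey]
  have hφ : 0 ≤ (Nat.totient M : ℝ) / M := by positivity
  rw [show (Nat.totient M : ℝ) / M * (emEulerIco M ω y Y)⁻¹ - (Nat.totient M : ℝ) / M =
      (Nat.totient M : ℝ) / M * ((emEulerIco M ω y Y)⁻¹ - 1) by ring, abs_mul, abs_of_nonneg hφ, mul_comm]
  exact mul_le_mul_of_nonneg_right (abs_inv_emEulerIco_sub_one_le hK₀ hωK hy) hφ

/-- `exp(2K₀/(y−1)) − 1 ≤ 4K₀/y` for `y > 2K₀²`, `K₀ ≥ 2` (`x = 2K₀/(y−1) ≤ 4/7`, `e^x − 1 ≤ x + x²`, `y − 1 ≥ 8y/9`). [folklore] -/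
private theorem exp_sub_one_le_four_mul {K₀ : ℝ} (hK₀ : 2 ≤ K₀) {y : ℕ} (hy : 2 * K₀ ^ 2 < y) :
    Real.exp (2 * K₀ / ((y : ℝ) - 1)) - 1 ≤ 4 * K₀ / y := by
  have hy8 : (8 : ℝ) < y := lt_of_le_of_lt (by nlinarith) hy
  have hy9 : (9 : ℝ) ≤ y := by
    have : 8 < y := by exact_mod_cast hy8
    exact_mod_cast (show 9 ≤ y by omega)
  have hy1 : 0 < (y : ℝ) - 1 := by linarith
  set x := 2 * K₀ / ((y : ℝ) - 1) with hx
  have hx0 : 0 ≤ x := by rw [hx]; positivity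
  -- `x ≤ 4/7`: `y − 1 ≥ 2K₀² − 1 ≥ (7/4)K₀²`... via `x (y-1) = 2K₀` and `y - 1 ≥ (7/2) K₀`
  have hy1' : (7 / 2) * K₀ ≤ (y : ℝ) - 1 := by nlinarith
  have hx1 : x ≤ 4 / 7 := by
    rw [hx, div_le_iff₀ hy1]; nlinarith
  have hxabs : |x| ≤ 1 := by rw [abs_of_nonneg hx0]; linarith
  have h1 := Real.abs_exp_sub_one_sub_id_le hxabs
  have h2 : Real.exp x - 1 ≤ x + x ^ 2 := by
    have := (abs_le.1 h1).2; linarith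
  -- `x ≤ (9/4) K₀ / y`
  have hx2 : x ≤ 9 / 4 * K₀ / y := by
    rw [hx, div_le_div_iff₀ hy1 (by linarith)]
    nlinarith
  have hy0 : (0 : ℝ) < y := by linarith
  calc Real.exp x - 1 ≤ x + x ^ 2 := h2
    _ ≤ x * (1 + 4 / 7) := by nlinarith
    _ ≤ (9 / 4 * K₀ / y) * (11 / 7) := by
        rw [show (1 : ℝ) + 4 / 7 = 11 / 7 by norm_num]
        exact mul_le_mul_of_nonneg_right hx2 (by norm_num)
    _ ≤ 4 * K₀ / y := by
        rw [div_mul_eq_mul_div, div_le_div_iff₀ hy0 hy0]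
        nlinarith

/-- **Quantitative (9.30), printed scale**: for `y > 2K₀²`,
`|c_γ · ∏_{p<y, p∤M}(p/(p−1) − 1/φ_ω(p)) − φ(M)/M| ≤ (4K₀/y) · φ(M)/M`.
[cite: Maynard2016DenseClusters, proof of Lemma 9.3 p. 24, displays (9.28)–(9.30)] -/
theorem abs_cGamma_mul_emEuler_sub_le' {M : ℕ} (hM : M ≠ 0) {K₀ : ℝ} (hK₀ : 2 ≤ K₀)
    (hsmall : ∀ p : ℕ, p.Prime → (p : ℝ) ≤ 2 * K₀ ^ 2 → p ∣ M) {ω : ℕ → ℕ}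
    (hωK : ∀ p : ℕ, p.Prime → ¬p ∣ M → (ω p : ℝ) ≤ K₀) (hω : ∀ p : ℕ, p.Prime → ¬p ∣ M → ω p < p)
    {y : ℕ} (hy : 2 * K₀ ^ 2 < y) :
    |GGPY.cGamma (emGamma M ω) * emEuler M ω y - (Nat.totient M : ℝ) / M| ≤
      4 * K₀ / y * ((Nat.totient M : ℝ) / M) :=
  (abs_cGamma_mul_emEuler_sub_le hM hK₀ hsmall hωK hω hy).trans
    (mul_le_mul_of_nonneg_right (exp_sub_one_le_four_mul hK₀ hy) (by positivity))

end Quantitative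

/-! ## §8 The inner sums of the error term (9.26) (first display of p. 24): the `t`-sum over `t ∣ Δ` and the `s`-sum -/

section ErrorSums

/-- `1 + ∑_{i∈T} xᵢ ≤ ∏_{i∈T} (1 + xᵢ)` for `xᵢ ≥ 0`. [folklore] -/
private theorem one_add_sum_le_prod_one_add {ι : Type*} [DecidableEq ι] (T : Finset ι) {x : ι → ℝ}
    (hx : ∀ i ∈ T, 0 ≤ x i) : 1 + ∑ i ∈ T, x i ≤ ∏ i ∈ T, (1 + x i) := by
  induction T using Finset.induction_on with
  | empty => simp
  | insert a T ha ih =>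
    have hxT : ∀ i ∈ T, 0 ≤ x i := fun i hi => hx i (Finset.mem_insert_of_mem hi)
    have hxa := hx a (Finset.mem_insert_self a T)
    have h1 := ih hxT
    have hσ : 0 ≤ ∑ i ∈ T, x i := Finset.sum_nonneg hxT
    rw [Finset.sum_insert ha, Finset.prod_insert ha]
    nlinarith [mul_nonneg hxa hσ, mul_nonneg hxa (by linarith : (0:ℝ) ≤ ∏ i ∈ T, (1 + x i) - (1 + ∑ i ∈ T, x i))]

/-- The powerset inequality behind the `t`-sum: for `b, c ≥ 0` on `P`,
`∑_{T ⊆ P} (∏_{p∈T} b_p)(1 + ∑_{p∈T} c_p) ≤ ∏_{p∈P}(1 + b_p) · (1 + ∑_{p∈P} b_p c_p)`. [folklore] -/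
private theorem sum_powerset_prod_mul_le {ι : Type*} [DecidableEq ι] (P : Finset ι) {b c : ι → ℝ}
    (hb : ∀ p ∈ P, 0 ≤ b p) (hc : ∀ p ∈ P, 0 ≤ c p) :
    ∑ T ∈ P.powerset, (∏ p ∈ T, b p) * (1 + ∑ p ∈ T, c p) ≤
      (∏ p ∈ P, (1 + b p)) * (1 + ∑ p ∈ P, b p * c p) := by
  induction P using Finset.induction_on with
  | empty => simp
  | insert a P ha ih =>
    have hbP : ∀ p ∈ P, 0 ≤ b p := fun p hp => hb p (Finset.mem_insert_of_mem hp)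
    have hcP : ∀ p ∈ P, 0 ≤ c p := fun p hp => hc p (Finset.mem_insert_of_mem hp)
    have hba := hb a (Finset.mem_insert_self a P)
    have hca := hc a (Finset.mem_insert_self a P)
    have ih' := ih hbP hcP
    have hQ : 0 ≤ ∏ p ∈ P, (1 + b p) := Finset.prod_nonneg fun p hp => by linarith [hbP p hp]
    have h2 : ∑ T ∈ P.powerset, (∏ p ∈ insert a T, b p) * (1 + ∑ p ∈ insert a T, c p) =
        b a * ∑ T ∈ P.powerset, (∏ p ∈ T, b p) * (1 + ∑ p ∈ T, c p) +
          b a * c a * ∑ T ∈ P.powerset, ∏ p ∈ T, b p := by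
      rw [Finset.mul_sum, Finset.mul_sum, ← Finset.sum_add_distrib]
      refine Finset.sum_congr rfl fun T hT => ?_
      have haT : a ∉ T := fun h => ha (Finset.mem_powerset.1 hT h)
      rw [Finset.prod_insert haT, Finset.sum_insert haT]
      ring
    rw [Finset.sum_powerset_insert ha, h2, ← Finset.prod_one_add, Finset.prod_insert ha, Finset.sum_insert ha]
    set S := ∑ T ∈ P.powerset, (∏ p ∈ T, b p) * (1 + ∑ p ∈ T, c p) with hS
    set Q := ∏ p ∈ P, (1 + b p) with hQdef
    set σ := ∑ p ∈ P, b p * c p with hσ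
    have hmid : S + (b a * S + b a * c a * Q) ≤ (1 + b a) * (Q * (1 + σ)) + b a * c a * Q := by
      nlinarith [mul_le_mul_of_nonneg_left ih' (by linarith : (0:ℝ) ≤ 1 + b a)]
    have hkey : (1 + b a) * Q * (1 + (b a * c a + σ)) - ((1 + b a) * (Q * (1 + σ)) + b a * c a * Q) =
        b a * b a * (c a * Q) := by ring
    nlinarith [mul_nonneg (mul_nonneg hba hba) (mul_nonneg hca hQ)]

/-- The primes of a square-free divisor `t ∣ D` coprime to `M` lie among the prime factors of `D` not dividing `M`.
[cite: Maynard2016DenseClusters, proof of Lemma 9.3 p. 24 («square-free t ∣ Δ with (t, WBre_ma_m) = 1»)] -/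
theorem primeFactors_subset_filter_of_dvd_coprime {D M t : ℕ} (hD : D ≠ 0) (htD : t ∣ D) (htM : Nat.Coprime t M) :
    t.primeFactors ⊆ D.primeFactors.filter (fun p => ¬p ∣ M) := by
  intro p hp
  have hpr := Nat.prime_of_mem_primeFactors hp
  have hpt := Nat.dvd_of_mem_primeFactors hp
  refine Finset.mem_filter.2 ⟨Nat.mem_primeFactors.2 ⟨hpr, hpt.trans htD, hD⟩, fun hpM => ?_⟩
  have h1 : p ∣ Nat.gcd t M := Nat.dvd_gcd hpt hpM
  rw [htM] at h1
  exact hpr.one_lt.ne' (Nat.dvd_one.1 h1)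

/-- `t ↦ primeFactors t` is injective on square-free numbers. [folklore] -/
private theorem injOn_primeFactors_of_squarefree {A : Finset ℕ} (hA : ∀ t ∈ A, Squarefree t) :
    Set.InjOn Nat.primeFactors (A : Set ℕ) := by
  intro t₁ h₁ t₂ h₂ h
  rw [← Nat.prod_primeFactors_of_squarefree (hA t₁ h₁), ← Nat.prod_primeFactors_of_squarefree (hA t₂ h₂), h]

/-- **The `t`-sum of (9.26)** (generic form of «∑_{t ∈ 𝒟_k : t∣Δ} (1 + ∑_{p∣t} log p)/φ_ω(t) ≪ (1 + ∑_{p>2k², p∣Δ} log p/p)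
∏_{p>2k², p∣Δ}(1 + 1/φ_ω(p))»): for `D ≠ 0`, `M` divisible by every prime `p ≤ 2K₀²` (`K₀ ≥ 2`) and
`ω(p) ≤ K₀` at the primes `p ∤ M`,
`∑_{t ∣ D, μ²(t) = 1, (t,M) = 1} (1 + ∑_{p∣t} log p)/∏_{p∣t}(p − ω(p))
 ≤ ∏_{p∣D, p∤M}(1 + 2/p) · (1 + ∑_{p∣D, p∤M} 2 log p/p)` (`φ_ω(p) ≥ p/2` there).
[cite: Maynard2016DenseClusters, proof of Lemma 9.3 p. 24, first display (the sum over t ∣ Δ)] -/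
theorem sum_divisors_log_div_phiOmega_le {D M : ℕ} (hD : D ≠ 0) {K₀ : ℝ} (hK₀ : 2 ≤ K₀)
    (hsmall : ∀ p : ℕ, p.Prime → (p : ℝ) ≤ 2 * K₀ ^ 2 → p ∣ M) {ω : ℕ → ℕ}
    (hωK : ∀ p : ℕ, p.Prime → ¬p ∣ M → (ω p : ℝ) ≤ K₀) :
    ∑ t ∈ D.divisors.filter (fun t => Squarefree t ∧ Nat.Coprime t M),
        (1 + ∑ p ∈ t.primeFactors, Real.log p) / ∏ p ∈ t.primeFactors, ((p : ℝ) - ω p) ≤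
      (∏ p ∈ D.primeFactors.filter (fun p => ¬p ∣ M), (1 + 2 / (p : ℝ))) *
        (1 + ∑ p ∈ D.primeFactors.filter (fun p => ¬p ∣ M), 2 * Real.log p / p) := by
  classical
  set P := D.primeFactors.filter (fun p => ¬p ∣ M) with hPdef
  set A := D.divisors.filter (fun t => Squarefree t ∧ Nat.Coprime t M) with hAdef
  -- the primes of `P`: `p > 2K₀²`, `φ_ω(p) ≥ p/2 > 0`
  have hP : ∀ p ∈ P, p.Prime ∧ (2 : ℝ) * K₀ ^ 2 < p ∧ (p : ℝ) / 2 ≤ (p : ℝ) - ω p := by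
    intro p hp
    have h := Finset.mem_filter.1 hp
    have hpr := Nat.prime_of_mem_primeFactors h.1
    have hbig : 2 * K₀ ^ 2 < (p : ℝ) := by
      by_contra hle
      exact h.2 (hsmall p hpr (not_lt.1 hle))
    have hω := hωK p hpr h.2
    refine ⟨hpr, hbig, ?_⟩
    nlinarith
  set G : Finset ℕ → ℝ := fun T => (1 + ∑ p ∈ T, Real.log p) / ∏ p ∈ T, ((p : ℝ) - ω p) with hGdef
  have hGnn : ∀ T ∈ P.powerset, 0 ≤ G T := by
    intro T hT
    have hTP := Finset.mem_powerset.1 hT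
    refine div_nonneg ?_ (Finset.prod_nonneg fun p hp => ?_)
    · have : 0 ≤ ∑ p ∈ T, Real.log p := Finset.sum_nonneg fun p hp => by
        have := (hP p (hTP hp)).1.one_lt.le
        exact Real.log_nonneg (by exact_mod_cast this)
      linarith
    · have h := hP p (hTP hp)
      have : (0 : ℝ) < p := by exact_mod_cast h.1.pos
      linarith [h.2.2]
  -- reindex by `t ↦ primeFactors t`
  have hinj : Set.InjOn Nat.primeFactors (A : Set ℕ) :=
    injOn_primeFactors_of_squarefree fun t ht => (Finset.mem_filter.1 ht).2.1
  have himg : A.image Nat.primeFactors ⊆ P.powerset := by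
    intro T hT
    obtain ⟨t, ht, rfl⟩ := Finset.mem_image.1 hT
    have h := Finset.mem_filter.1 ht
    exact Finset.mem_powerset.2
      (primeFactors_subset_filter_of_dvd_coprime hD (Nat.dvd_of_mem_divisors h.1) h.2.2)
  have hstep1 : ∑ t ∈ A, G t.primeFactors ≤ ∑ T ∈ P.powerset, G T := by
    rw [← Finset.sum_image hinj]
    exact Finset.sum_le_sum_of_subset_of_nonneg himg fun T hT _ => hGnn T hT
  -- termwise: `1/∏(p − ω) ≤ ∏ 2/p` on subsets of `P`
  have hstep2 : ∀ T ∈ P.powerset,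
      G T ≤ (∏ p ∈ T, (2 / (p : ℝ))) * (1 + ∑ p ∈ T, Real.log p) := by
    intro T hT
    have hTP := Finset.mem_powerset.1 hT
    have hPipos : 0 < ∏ p ∈ T, ((p : ℝ) - ω p) := Finset.prod_pos fun p hp => by
      have h := hP p (hTP hp)
      have : (0 : ℝ) < p := by exact_mod_cast h.1.pos
      linarith [h.2.2]
    have hL : 0 ≤ 1 + ∑ p ∈ T, Real.log p := by
      have : 0 ≤ ∑ p ∈ T, Real.log p := Finset.sum_nonneg fun p hp => by
        have := (hP p (hTP hp)).1.one_lt.le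
        exact Real.log_nonneg (by exact_mod_cast this)
      linarith
    have hone : 1 ≤ (∏ p ∈ T, (2 / (p : ℝ))) * ∏ p ∈ T, ((p : ℝ) - ω p) := by
      rw [← Finset.prod_mul_distrib, ← Finset.prod_const_one (s := T)]
      refine Finset.prod_le_prod (fun _ _ => zero_le_one) fun p hp => ?_
      have h := hP p (hTP hp)
      have hp0 : (0 : ℝ) < p := by exact_mod_cast h.1.pos
      rw [div_mul_eq_mul_div, le_div_iff₀ hp0]
      linarith [h.2.2]
    show (1 + ∑ p ∈ T, Real.log p) / ∏ p ∈ T, ((p : ℝ) - ω p) ≤ _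
    rw [div_le_iff₀ hPipos]
    calc 1 + ∑ p ∈ T, Real.log p = (1 + ∑ p ∈ T, Real.log p) * 1 := (mul_one _).symm
      _ ≤ (1 + ∑ p ∈ T, Real.log p) * ((∏ p ∈ T, (2 / (p : ℝ))) * ∏ p ∈ T, ((p : ℝ) - ω p)) :=
          mul_le_mul_of_nonneg_left hone hL
      _ = (∏ p ∈ T, (2 / (p : ℝ))) * (1 + ∑ p ∈ T, Real.log p) * ∏ p ∈ T, ((p : ℝ) - ω p) := by ring
  have hb : ∀ p ∈ P, (0 : ℝ) ≤ 2 / (p : ℝ) := fun p _ => by positivity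
  have hc : ∀ p ∈ P, 0 ≤ Real.log p := fun p hp => by
    have := (hP p hp).1.one_lt.le
    exact Real.log_nonneg (by exact_mod_cast this)
  calc ∑ t ∈ A, G t.primeFactors ≤ ∑ T ∈ P.powerset, G T := hstep1
    _ ≤ ∑ T ∈ P.powerset, (∏ p ∈ T, (2 / (p : ℝ))) * (1 + ∑ p ∈ T, Real.log p) :=
        Finset.sum_le_sum hstep2
    _ ≤ (∏ p ∈ P, (1 + 2 / (p : ℝ))) * (1 + ∑ p ∈ P, 2 / (p : ℝ) * Real.log p) :=
        sum_powerset_prod_mul_le P hb hc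
    _ = (∏ p ∈ P, (1 + 2 / (p : ℝ))) * (1 + ∑ p ∈ P, 2 * Real.log p / p) := by
        congr 1; congr 1
        exact Finset.sum_congr rfl fun p _ => by ring

/-- `φ(s) = ∏_{p ∣ s} (p − 1)` over `ℝ` for square-free `s`. [folklore] -/
private theorem cast_totient_eq_prod_of_squarefree {s : ℕ} (hs : Squarefree s) :
    (Nat.totient s : ℝ) = ∏ p ∈ s.primeFactors, ((p : ℝ) - 1) := by
  have h := Nat.totient_mul_prod_primeFactors s
  rw [Nat.prod_primeFactors_of_squarefree hs] at h
  have hs0 : s ≠ 0 := hs.ne_zero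
  have h' : Nat.totient s = ∏ p ∈ s.primeFactors, (p - 1) :=
    Nat.eq_of_mul_eq_mul_right (Nat.pos_of_ne_zero hs0) (by rw [h, mul_comm])
  rw [h', Nat.cast_prod]
  refine Finset.prod_congr rfl fun p hp => ?_
  rw [Nat.cast_sub (Nat.prime_of_mem_primeFactors hp).one_le, Nat.cast_one]

/-- **The `s`-sum of (9.26)** (generic form of «the sum over s then factorizes as an Euler product, which can be seen
to be O(1) since there are O(ω(u)) choices of 𝐬 with s = u, and we only consider primes p > 2k²»): for `M`
divisible by every prime `p ≤ 2K₀²` (`K₀ ≥ 2`), `ω(p) ≤ K₀` at the primes `p ∤ M`, and ANY finite set `S` of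
square-free numbers coprime to `M`,
`∑_{s ∈ S} K₀^{#primes(s)} (1 + log s)/(φ(s) φ_ω(s)) ≤ e⁶` (weights `≤ 4K₀(1 + log p)/p²` at the primes `p > 2K₀²`,
`∑_{p > 2K₀²} (1 + log p)/p² ≤ (1 + 3 log 4)/⌊2K₀²⌋`).
[cite: Maynard2016DenseClusters, proof of Lemma 9.3 p. 24, first display (the sum over s)] -/
theorem sum_sqfree_coprime_pow_mul_log_div_le {M : ℕ} {K₀ : ℝ} (hK₀ : 2 ≤ K₀)
    (hsmall : ∀ p : ℕ, p.Prime → (p : ℝ) ≤ 2 * K₀ ^ 2 → p ∣ M) {ω : ℕ → ℕ}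
    (hωK : ∀ p : ℕ, p.Prime → ¬p ∣ M → (ω p : ℝ) ≤ K₀)
    (S : Finset ℕ) (hS : ∀ s ∈ S, Squarefree s ∧ Nat.Coprime s M) :
    ∑ s ∈ S, K₀ ^ s.primeFactors.card * (1 + Real.log s) /
        ((Nat.totient s : ℝ) * ∏ p ∈ s.primeFactors, ((p : ℝ) - ω p)) ≤ Real.exp 6 := by
  classical
  set P := S.biUnion Nat.primeFactors with hPdef
  have hP : ∀ p ∈ P, p.Prime ∧ ¬p ∣ M ∧ (2 : ℝ) * K₀ ^ 2 < p ∧ (ω p : ℝ) ≤ K₀ := by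
    intro p hp
    obtain ⟨s, hs, hps⟩ := Finset.mem_biUnion.1 hp
    have hpr := Nat.prime_of_mem_primeFactors hps
    have hpM : ¬p ∣ M := fun hpM => by
      have h1 : p ∣ Nat.gcd s M := Nat.dvd_gcd (Nat.dvd_of_mem_primeFactors hps) hpM
      rw [(hS s hs).2] at h1
      exact hpr.one_lt.ne' (Nat.dvd_one.1 h1)
    have hbig : 2 * K₀ ^ 2 < (p : ℝ) := by
      by_contra hle
      exact hpM (hsmall p hpr (not_lt.1 hle))
    exact ⟨hpr, hpM, hbig, hωK p hpr hpM⟩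
  have hK0 : 0 ≤ K₀ := by linarith
  -- consequences at a prime of `P`
  have hP' : ∀ p ∈ P, (2 : ℝ) ≤ p ∧ (p : ℝ) / 2 ≤ (p : ℝ) - 1 ∧ (p : ℝ) / 2 ≤ (p : ℝ) - ω p ∧
      0 ≤ Real.log p := by
    intro p hp
    obtain ⟨hpr, -, hbig, hω⟩ := hP p hp
    have h2 : (2 : ℝ) ≤ p := by exact_mod_cast hpr.two_le
    have hK2 : 2 * K₀ ≤ 2 * K₀ ^ 2 := by nlinarith
    refine ⟨h2, by linarith, by linarith, Real.log_nonneg (by linarith)⟩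
  -- the weight
  set w : ℕ → ℝ := fun p => K₀ * (1 + Real.log p) / (((p : ℝ) - 1) * ((p : ℝ) - ω p)) with hwdef
  have hw_nonneg : ∀ p ∈ P, 0 ≤ w p := by
    intro p hp
    obtain ⟨h2, hd1, hd2, hlog⟩ := hP' p hp
    simp only [hwdef]
    exact div_nonneg (mul_nonneg hK0 (by linarith)) (mul_nonneg (by linarith) (by linarith))
  have hw_le : ∀ p ∈ P, w p ≤ 4 * K₀ * (1 / (p : ℝ) ^ 2 + Real.log p / (p : ℝ) ^ 2) := by
    intro p hp
    obtain ⟨h2, hd1, hd2, hlog⟩ := hP' p hp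
    have hp0 : (0 : ℝ) < p := by linarith
    have hden : (p : ℝ) ^ 2 / 4 ≤ ((p : ℝ) - 1) * ((p : ℝ) - ω p) := by
      have := mul_le_mul hd1 hd2 (by positivity) (by linarith)
      linarith [show (p : ℝ) / 2 * ((p : ℝ) / 2) = (p : ℝ) ^ 2 / 4 by ring]
    simp only [hwdef]
    calc K₀ * (1 + Real.log p) / (((p : ℝ) - 1) * ((p : ℝ) - ω p))
        ≤ K₀ * (1 + Real.log p) / ((p : ℝ) ^ 2 / 4) :=
          div_le_div_of_nonneg_left (mul_nonneg hK0 (by linarith)) (by positivity) hden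
      _ = 4 * K₀ * (1 / (p : ℝ) ^ 2 + Real.log p / (p : ℝ) ^ 2) := by
          field_simp
  -- termwise bound by the multiplicative weight
  have hterm : ∀ s ∈ S, K₀ ^ s.primeFactors.card * (1 + Real.log s) /
      ((Nat.totient s : ℝ) * ∏ p ∈ s.primeFactors, ((p : ℝ) - ω p)) ≤ ∏ p ∈ s.primeFactors, w p := by
    intro s hs
    obtain ⟨hsq, -⟩ := hS s hs
    have hsub : s.primeFactors ⊆ P := Finset.subset_biUnion_of_mem Nat.primeFactors hs
    rw [cast_totient_eq_prod_of_squarefree hsq]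
    have hd1 : 0 < ∏ p ∈ s.primeFactors, ((p : ℝ) - 1) :=
      Finset.prod_pos fun p hp => by linarith [(hP' p (hsub hp)).1]
    have hd2 : 0 < ∏ p ∈ s.primeFactors, ((p : ℝ) - ω p) :=
      Finset.prod_pos fun p hp => by linarith [(hP' p (hsub hp)).1, (hP' p (hsub hp)).2.2.1]
    have hlog : 1 + Real.log s ≤ ∏ p ∈ s.primeFactors, (1 + Real.log p) := by
      have hcast : (s : ℝ) = ∏ p ∈ s.primeFactors, (p : ℝ) := by
        rw [← Nat.cast_prod, Nat.prod_primeFactors_of_squarefree hsq]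
      rw [hcast, Real.log_prod (fun p hp => by
        have := (hP' p (hsub hp)).1
        exact (show (0 : ℝ) < p by linarith).ne')]
      exact one_add_sum_le_prod_one_add _ fun p hp => (hP' p (hsub hp)).2.2.2
    have hK : K₀ ^ s.primeFactors.card = ∏ _p ∈ s.primeFactors, K₀ := (Finset.prod_const K₀).symm
    rw [div_le_iff₀ (mul_pos hd1 hd2), hK]
    have hKnn : 0 ≤ ∏ _p ∈ s.primeFactors, K₀ := Finset.prod_nonneg fun _ _ => hK0
    calc (∏ _p ∈ s.primeFactors, K₀) * (1 + Real.log s)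
        ≤ (∏ _p ∈ s.primeFactors, K₀) * ∏ p ∈ s.primeFactors, (1 + Real.log p) :=
          mul_le_mul_of_nonneg_left hlog hKnn
      _ = (∏ p ∈ s.primeFactors, w p) *
            ((∏ p ∈ s.primeFactors, ((p : ℝ) - 1)) * ∏ p ∈ s.primeFactors, ((p : ℝ) - ω p)) := by
          rw [← Finset.prod_mul_distrib, ← Finset.prod_mul_distrib, ← Finset.prod_mul_distrib]
          refine Finset.prod_congr rfl fun p hp => ?_
          obtain ⟨h2, hd1', hd2', -⟩ := hP' p (hsub hp)
          have hne : ((p : ℝ) - 1) * ((p : ℝ) - ω p) ≠ 0 :=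
            (mul_pos (by linarith) (by linarith)).ne'
          simp only [hwdef]
          rw [div_mul_cancel₀ _ hne]
  -- sum over `S` ≤ sum over the subsets of `P` = `∏_P (1 + w)`
  have hinj : Set.InjOn Nat.primeFactors (S : Set ℕ) :=
    injOn_primeFactors_of_squarefree fun s hs => (hS s hs).1
  have himg : S.image Nat.primeFactors ⊆ P.powerset := fun T hT => by
    obtain ⟨s, hs, rfl⟩ := Finset.mem_image.1 hT
    exact Finset.mem_powerset.2 (Finset.subset_biUnion_of_mem Nat.primeFactors hs)
  have hsum : ∑ s ∈ S, ∏ p ∈ s.primeFactors, w p ≤ ∏ p ∈ P, (1 + w p) := by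
    rw [Finset.prod_one_add]
    calc ∑ s ∈ S, ∏ p ∈ s.primeFactors, w p = ∑ T ∈ S.image Nat.primeFactors, ∏ p ∈ T, w p :=
          (Finset.sum_image (f := fun T => ∏ p ∈ T, w p) hinj).symm
      _ ≤ ∑ T ∈ P.powerset, ∏ p ∈ T, w p :=
          Finset.sum_le_sum_of_subset_of_nonneg himg fun T hT _ =>
            Finset.prod_nonneg fun p hp => hw_nonneg p ((Finset.mem_powerset.1 hT) hp)
  have hexp : ∏ p ∈ P, (1 + w p) ≤ Real.exp (∑ p ∈ P, w p) := by
    rw [Real.exp_sum]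
    exact Finset.prod_le_prod (fun p hp => by linarith [hw_nonneg p hp]) fun p hp => by
      linarith [Real.add_one_le_exp (w p)]
  -- the numerical bound `∑_P w ≤ 6`
  have hSum6 : ∑ p ∈ P, w p ≤ 6 := by
    set H := ⌊2 * K₀ ^ 2⌋₊ with hHdef
    have hH8 : 8 ≤ H := Nat.le_floor (by push_cast; nlinarith)
    have hHle : (H : ℝ) ≤ 2 * K₀ ^ 2 := Nat.floor_le (by positivity)
    have hHgt : 2 * K₀ ^ 2 - 1 < (H : ℝ) := by
      have := Nat.lt_floor_add_one (2 * K₀ ^ 2); linarith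
    have hHpos : (0 : ℝ) < H := by exact_mod_cast (show 0 < H by omega)
    have hPgt : ∀ p ∈ P, H < p := fun p hp => by
      exact_mod_cast (lt_of_le_of_lt hHle (hP p hp).2.2.1)
    have h1 : ∑ p ∈ P, 1 / (p : ℝ) ^ 2 ≤ 1 / (H : ℝ) := by
      have h := sum_inv_sq_le_of_le P (y := H + 1) (by omega) fun p hp => Nat.succ_le_of_lt (hPgt p hp)
      push_cast at h
      simpa using h
    have h2 : ∑ p ∈ P, Real.log p / (p : ℝ) ^ 2 ≤ 3 * Real.log 4 / H := by
      have hfilt : P.filter (fun p => p.Prime ∧ H < p) = P :=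
        Finset.filter_true_of_mem fun p hp => ⟨(hP p hp).1, hPgt p hp⟩
      have h := sum_filter_prime_gt_log_div_sq_le (le_trans (by norm_num) hH8) P
      rwa [hfilt] at h
    have hlog4 : Real.log 4 < 1.3863 := by
      have h2' := Real.log_two_lt_d9
      rw [show (4 : ℝ) = 2 ^ 2 by norm_num, Real.log_pow]
      push_cast
      linarith
    calc ∑ p ∈ P, w p ≤ ∑ p ∈ P, 4 * K₀ * (1 / (p : ℝ) ^ 2 + Real.log p / (p : ℝ) ^ 2) :=
          Finset.sum_le_sum hw_le
      _ = 4 * K₀ * (∑ p ∈ P, 1 / (p : ℝ) ^ 2 + ∑ p ∈ P, Real.log p / (p : ℝ) ^ 2) := by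
          rw [← Finset.sum_add_distrib, Finset.mul_sum]
      _ ≤ 4 * K₀ * (1 / (H : ℝ) + 3 * Real.log 4 / H) := by gcongr
      _ = 4 * K₀ * (1 + 3 * Real.log 4) / H := by
          field_simp
      _ ≤ 6 := by
          rw [div_le_iff₀ hHpos]
          nlinarith
  calc ∑ s ∈ S, K₀ ^ s.primeFactors.card * (1 + Real.log s) /
          ((Nat.totient s : ℝ) * ∏ p ∈ s.primeFactors, ((p : ℝ) - ω p))
      ≤ ∑ s ∈ S, ∏ p ∈ s.primeFactors, w p := Finset.sum_le_sum hterm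
    _ ≤ ∏ p ∈ P, (1 + w p) := hsum
    _ ≤ Real.exp (∑ p ∈ P, w p) := hexp
    _ ≤ Real.exp 6 := Real.exp_le_exp.2 hSum6

end ErrorSums

/-! ## §9 The size of the `e_m`-summation error against `∫₀^∞ F₂ dt_m`: `T_k ∏_{i≠m} g_k(uᵢ) ≤ 2T_k ∫₀^∞ F₂(u; u_m := t) dt` -/

section FiberSize

variable {k : ℕ}

/-- The `j ≠ m` terms of the fibre of `F₂` dominate `(k − 1) ∏_{i≠m} g_k(uᵢ)` (`h_k ≥ g_k` on `[0, ∞)`):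
`(k − 1) ∏_{i≠m} g_k(uᵢ) ≤ ∑_{j≠m} h_k(u_j) ∏_{i≠j,m} g_k(uᵢ)` for `u` in the orthant.
[cite: Maynard2016DenseClusters, (7.6) (F₂ = ∑ⱼ h_k(t_j)∏_{i≠j} g_k(t_i)) with Lemma 9.3 p. 22 (9.14) (the F₂-integral of the error)] -/
theorem card_sub_one_mul_prod_le_sum (hk : 2 ≤ k) {u : Fin k → ℝ} (hu : u ∈ orthant k) (m : Fin k) :
    ((k : ℝ) - 1) * ∏ i ∈ univ.erase m, prof k (u i) ≤
      ∑ j ∈ univ.erase m, prof₂ k (u j) * ∏ i ∈ (univ.erase m).erase j, prof k (u i) := by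
  have hcard : ((univ.erase m).card : ℝ) = (k : ℝ) - 1 := by
    rw [Finset.card_erase_of_mem (Finset.mem_univ m), Finset.card_univ, Fintype.card_fin,
      Nat.cast_sub (le_trans (by norm_num) hk), Nat.cast_one]
  calc ((k : ℝ) - 1) * ∏ i ∈ univ.erase m, prof k (u i)
      = ∑ _j ∈ univ.erase m, ∏ i ∈ univ.erase m, prof k (u i) := by
        rw [Finset.sum_const, nsmul_eq_mul, hcard]
    _ = ∑ j ∈ univ.erase m, prof k (u j) * ∏ i ∈ (univ.erase m).erase j, prof k (u i) :=
        Finset.sum_congr rfl fun j hj => (Finset.mul_prod_erase (univ.erase m) (fun i => prof k (u i)) hj).symm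
    _ ≤ ∑ j ∈ univ.erase m, prof₂ k (u j) * ∏ i ∈ (univ.erase m).erase j, prof k (u i) :=
        Finset.sum_le_sum fun j _ => mul_le_mul_of_nonneg_right (prof_le_prof₂ hk (mem_orthant.1 hu j))
          (Finset.prod_nonneg fun i _ => prof_nonneg hk (mem_orthant.1 hu i))

/-- **`k L_k ∏_{i≠m} g_k(uᵢ) ≤ ∫₀^∞ F₂(u; u_m := t) dt`** for `u` in the orthant (`k ≥ 2`):
`∫ F₂ dt_m = (∫h_k)∏ + L_k ∑_{j≠m} h_k(u_j)∏_{i≠j,m} g_k ≥ L_k ∏ + L_k (k−1) ∏`.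
[cite: Maynard2016DenseClusters, Lemma 9.3 p. 22 (9.14) with (7.6) and Lemma 8.6 p. 18] -/
theorem mul_ell_mul_prod_le_setIntegral_F₂_update (hk : 2 ≤ k) {u : Fin k → ℝ} (hu : u ∈ orthant k)
    (m : Fin k) :
    (k : ℝ) * ell k * ∏ i ∈ univ.erase m, prof k (u i) ≤ ∫ t in Set.Ici (0 : ℝ), F₂ k (Function.update u m t) := by
  rw [setIntegral_Ici_F₂_update hk u m]
  have hα0 : 0 ≤ ∏ i ∈ univ.erase m, prof k (u i) :=
    Finset.prod_nonneg fun i _ => prof_nonneg hk (mem_orthant.1 hu i)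
  have h1 := card_sub_one_mul_prod_le_sum hk hu m
  have hell := ell_pos hk
  have hell₂ := ell_le_ell₂ hk
  nlinarith [mul_le_mul_of_nonneg_left h1 hell.le, mul_le_mul_of_nonneg_right hell₂ hα0]

/-- **The `e_m`-summation error is `O(T_k ∫ F₂ dt_m)`** (`k ≥ 2^18`, `u` in the orthant):
`T_k ∏_{i≠m} g_k(uᵢ) ≤ 2 T_k ∫₀^∞ F₂(u; u_m := t) dt` (`T_k = k log k`, `L_k T_k ≥ (log k)/2`), so the error
`C c_γ (9 + ∑_{p∣M} log p/p)·93 T_k ∏_{i≠m} g_k(uᵢ)` of `emSummation` is `≪ c_γ log log R · T_k ∫ F₂ dt_m`, inside the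
printed `O(T_k (log log R)² …∫ F₂ dt_m)` of (9.14).
[cite: Maynard2016DenseClusters, Lemma 9.3 p. 22 (9.14) (the error term T_k (log log R)² ∫ F₂ dt_m), proof p. 24] -/
theorem T_mul_prod_le_two_mul_T_mul_setIntegral_F₂_update (hk : 262144 ≤ k) {u : Fin k → ℝ}
    (hu : u ∈ orthant k) (m : Fin k) :
    T k * ∏ i ∈ univ.erase m, prof k (u i) ≤ 2 * T k * ∫ t in Set.Ici (0 : ℝ), F₂ k (Function.update u m t) := by
  have hk2 : 2 ≤ k := le_trans (by norm_num) hk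
  have h := mul_ell_mul_prod_le_setIntegral_F₂_update hk2 hu m
  have hell := ell_mul_T_ge hk
  have hT := T_pos hk2
  have hα0 : 0 ≤ ∏ i ∈ univ.erase m, prof k (u i) :=
    Finset.prod_nonneg fun i _ => prof_nonneg hk2 (mem_orthant.1 hu i)
  have hkpos : (0 : ℝ) < k := by exact_mod_cast (show 0 < k by omega)
  have hlogk : 0 < Real.log k := Real.log_pos (by exact_mod_cast (show 1 < k by omega))
  -- `k L_k ≥ 1/2` (from `L_k T_k ≥ (log k)/2`, `T_k = k log k`), so `∏ ≤ 2 ∫F₂` and `T_k ∏ ≤ 2T_k ∫F₂`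
  have hTdef : T k = k * Real.log k := rfl
  have hkell : 1 / 2 ≤ (k : ℝ) * ell k := by
    have h1 : Real.log k / 2 ≤ ell k * (k * Real.log k) := by rw [← hTdef]; exact hell
    have h2 : Real.log k * (1 / 2) ≤ Real.log k * (k * ell k) := by nlinarith
    exact le_of_mul_le_mul_left h2 hlogk
  have hα : ∏ i ∈ univ.erase m, prof k (u i) ≤ 2 * ∫ t in Set.Ici (0 : ℝ), F₂ k (Function.update u m t) := by
    nlinarith [mul_le_mul_of_nonneg_right hkell hα0]
  nlinarith [mul_le_mul_of_nonneg_left hα hT.le]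

end FiberSize

end MaynardDense

end Literature.NumberTheory.Sieve
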